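import Literature.Probability.RandomPlanarGeometry.SAWPulledLargeForceExpansionZdSecondSymbol
import Literature.Probability.RandomPlanarGeometry.SAWPulledLargeForceExpansionZdCostPolynomial
import Literature.Probability.RandomPlanarGeometry.SAWCountZdThirdCoefficient
import Literature.Probability.RandomPlanarGeometry.SAWIrreducibleBridgeSpanTwoTopClassCount
import HarnessLib

/-!
# Pulled SAW on `ℤ^{d+1}`: the THIRD SYMBOL of the cost census and the SECOND COEFFICIENT `(−1)^{k−1}2^{k−2}(k²−5k+7)` of `c_k^{(d)}`

Topic `Literature/Probability/RandomPlanarGeometry` (continues `SAWPulledLargeForceExpansionZdSecondSymbol.lean`: the symbol PAIRS of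
`[X^i] A_K` converge to `(ι, θ) = ((1+2X)⁻¹, 2X²(1+2X)⁻³)` (`exists_symbolPair_coeff_A`) and `deg_d c_k^{(d)} = k − 1` with leading
coefficient `(−2)^{k−1}` (`exists_polynomial_largeForceCoeffZd_natDegree_eq`); uses `SAWCountZdThirdCoefficient.lean`: the top THREE
coefficients `2^n, −(n−1)2^{n−1}, 2^{n−3}(n²−5n+8)` of `c_n(ℤ^d)` (`exists_polynomial_count_topThree`); `SAWIrreducibleBridgeSpanTwoTopClassCount.lean`:
the one-down-step class of the span-two cell, `card_spanTwoTopClass : F_{u+2,u+4}(u) = 2^u·u!·C(u+1,3)`; `SAWIrreducibleBridgeSpanOne.lean`: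
`N_{c,c+1}(ℤ^{d+1}) = c_c(ℤ^d)`, `c₁ = 2d`, `c₂ = 2d(2d−1)`; `SAWPulledLargeForceExpansionZdCostPolynomial.lean` /
`…ZdDegreeProfile.lean`: the axis-class identity `N_{c,n}(ℤ^{d+1}) = Σ_u C(d,u)F_{c,n}(u)` and `deg_d N_{c,n} ≤ 3c + 2 − 2n`;
`…ZdFourthOrder.lean`: `costCoeffZd_eq_zero_of_le`; and the tree's cost-series engine `CostSeries.Pz / A / E`,
`largeForceCoeffZd d k = c_k^{(d)} = [X^k] E_k`).

PRINTED CONTEXT (locators only; nothing below is quoted digit-for-digit). Madras–Slade (1993) §1.1 eq. (1.1.8) p. 5 (the `1/d` expansion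
of `μ` after Fisher–Sykes 1959 / Fisher–Gaunt 1964) and §4.2 eq. (4.2.20)–(4.2.22) (cost = length − span of a bridge). NOT IN PRINT (lane
statements): everything below — the objects `c_k^{(d)}` (large-force coefficients of the pulled self-avoiding walk on `ℤ^{d+1}`) are the lane's.

PART I — THIRD-ORDER SYMBOL CALCULUS (inline predicate `∃ P, natDegree P ≤ m ∧ [X^m]P = a ∧ [X^m](P·X) = b ∧ [X^m](P·X²) = c ∧ ∀ d, f d = P(d)`;
products obey `(a,b,c)(a′,b′,c′) = (aa′, ab′+ba′, ac′+bb′+ca′)` uniformly in `m`, via `Polynomial.reflect`; powers carry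
`(σⁿ, nσⁿ⁻¹τ, nσⁿ⁻¹υ + C(n,2)σⁿ⁻²τ²)`).
PART II — ★★ `exists_polynomial_costCoeffZd_topThree` — THE THIRD SYMBOL OF THE COST CENSUS: for `c ≥ 1` the `d^c`-, `d^{c−1}`-, `d^{c−2}`-
coefficients of `N_{c,n}(ℤ^{d+1})` are `(2^c, −(c−1)2^{c−1}, t₃(c))` on the span-one cell `n = c+1` (`t₃(c) = 2^{c−3}(c²−5c+8)` for `c ≥ 3`,
`0` for `c = 1, 2`), `(0, 0, C(c−1,3)2^{c−2})` on the span-two cell `n = c+2` (★ `exists_polynomial_costCoeffZd_spanTwo`), `(0,0,0)` elsewhere.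
PART III — the engine step on symbol TRIPLES (`gsym3_A_succ`) and ★★ the third-order fixed point (`alg3_A_step_third`): with `w = 2Xι`,
the third symbols of `[X^i] A_K` converge to `κ = −2X³(1 − 2X + 4X²)ι⁵ = −(w³/4)(1 − 3w + 3w²)`. The five finite sums of the recursion
(`Σ(j+2)w^j`, `ΣC(j+2,2)w^j`, `Σj(j+2)w^j`, `Σ(j²−3j+4)w^j`, `ΣC(j,3)w^j` against `ι^{2…4} = (1−w)^{2…4}`) TELESCOPE: `24ι⁴ ×` (recursion at
`(ι,θ,κ)`) `= −(A(w) + w^{K+2}R_K(w)) + 24Xι⁶ + 24X²ι⁷` with explicit polynomials `A`, `R_K` (a certificate found by computer algebra and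
checked by `ring`, `alg3_model_sum`), the two monomials being the corrections of the cells `c = 1, 2` where `t₃ = 0`; and
`−A(w) + 24Xι⁶ + 24X²ι⁷ = 24ι⁴κ` (`alg3_close`).
PART IV — ★ `exists_symbolTriple_coeff_A` (top and second symbols identified with the second-symbol file's by uniqueness of the polynomial)
and ★★★ `exists_polynomial_largeForceCoeffZd_secondCoeff` / `…_topThree`: for every `k ≥ 3`, `d ↦ c_k^{(d)}` is a polynomial of degree
EXACTLY `k − 1` with `[d^{k−1}] = (−2)^{k−1}` and `[d^{k−2}] c_k^{(d)} = (−1)^{k−1} 2^{k−2} (k² − 5k + 7)`: the third symbol of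
`E_k = Σ_{j≤k}(1 − A_k)^j` is `−κ/ι² + θ²/ι³ = 2X³(1 + 4X²)ι³` (`alg3_E`), whose `X^k`-coefficient is that number. This settles the lane's
amendment AZ («THIRD SYMBOL», registered blind and verified at `k = 10`: `−14592`) in full: THEOREM for every `k`.
[cite: MadrasSlade1993, §1.1 eq. (1.1.8) p. 5; §4.2 eq. (4.2.20)–(4.2.22)] [cite: DuminilCopinHammond2013, §2.2 (irreducible bridges)]

Provenance: lane «pcv-sawmu», a-p1 g19 (2026-08-26), executing a-p1 g18's design `DESIGN-ZD-THIRD-SYMBOL.md`. Data (not used; the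
mechanism was validated on it first, exact rational arithmetic): `[d^{k−2}] c_k^{(d)} = 2, −12, 56, −208, 672, −1984` for `k = 3 … 8`
(lane census and a-p3's closed forms `c₅ … c₈^{(d)}`), `5504` (`k = 9`), `−14592` (`k = 10`, blind); the SAW − non-reversing difference at
this order is `−4[X^{k−4}](1+2X)⁻³`, carried by the unit-square class alone.
-/

noncomputable section

open Finset
open scoped BigOperators
open Literature.Probability.LatticeModels
open Literature.Probability.RandomPlanarGeometry.SAW

namespace Literature.Probability.RandomPlanarGeometry.SAW.Zd

/-! ### Third-order symbols of polynomial-in-`d` functions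

Inline predicate («`f` has degree `≤ m`, top coefficient `a`, second coefficient `b`, third coefficient `c`»):
`∃ P : ℚ[X], P.natDegree ≤ m ∧ P.coeff m = a ∧ (P * X).coeff m = b ∧ (P * X^2).coeff m = c ∧ ∀ d : ℕ, f d = P.eval d`
(`(P * X^2).coeff m` is `P.coeff (m − 2)` for `m ≥ 2` and `0` otherwise, so that the product rule holds without case distinction). -/

section Symbol3

/-- `[X^0]` of the reflection is the top coefficient. [cite: MadrasSlade1993, §1.1 eq. (1.1.8) p. 5; lane plumbing] -/
private theorem st_reflect_coeff_zero (P : Polynomial ℚ) (m : ℕ) : (Polynomial.reflect m P).coeff 0 = P.coeff m := by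
  rw [Polynomial.coeff_reflect, Polynomial.revAt_le (Nat.zero_le m), Nat.sub_zero]

/-- `[X^1]` of the reflection is the second coefficient `[X^m](P · X)`. [cite: MadrasSlade1993, §1.1 eq. (1.1.8) p. 5; lane plumbing] -/
private theorem st_reflect_coeff_one {P : Polynomial ℚ} {m : ℕ} (hP : P.natDegree ≤ m) :
    (Polynomial.reflect m P).coeff 1 = (P * Polynomial.X).coeff m := by
  rcases m with _ | m
  · rw [Polynomial.coeff_reflect, Polynomial.mul_coeff_zero, Polynomial.coeff_X_zero, mul_zero]
    have h1 : Polynomial.revAt 0 1 = 1 := by decide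
    rw [h1]
    exact Polynomial.coeff_eq_zero_of_natDegree_lt (by omega)
  · rw [Polynomial.coeff_reflect, Polynomial.revAt_le (by omega : 1 ≤ m + 1), Nat.add_sub_cancel, Polynomial.coeff_mul_X]

/-- `[X^2]` of the reflection is the third coefficient `[X^m](P · X²)`. [cite: MadrasSlade1993, §1.1 eq. (1.1.8) p. 5; lane plumbing] -/
private theorem st_reflect_coeff_two {P : Polynomial ℚ} {m : ℕ} (hP : P.natDegree ≤ m) :
    (Polynomial.reflect m P).coeff 2 = (P * Polynomial.X ^ 2).coeff m := by
  rw [Polynomial.coeff_reflect, Polynomial.coeff_mul_X_pow']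
  by_cases h : 2 ≤ m
  · rw [Polynomial.revAt_le h, if_pos h]
  · rw [if_neg h]
    have h1 : Polynomial.revAt m 2 = 2 := by
      unfold Polynomial.revAt
      simp only [Function.Embedding.coeFn_mk, ite_eq_right_iff]
      omega
    rw [h1]
    exact Polynomial.coeff_eq_zero_of_natDegree_lt (by omega)

/-- `[X^1](p · q) = p₀ q₁ + p₁ q₀`. [cite: MadrasSlade1993, §1.1 eq. (1.1.8) p. 5; lane plumbing] -/
private theorem st_coeff_one_mul (p q : Polynomial ℚ) : (p * q).coeff 1 = p.coeff 0 * q.coeff 1 + p.coeff 1 * q.coeff 0 := by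
  rw [Polynomial.coeff_mul, Finset.Nat.sum_antidiagonal_succ, Finset.Nat.antidiagonal_zero, Finset.sum_singleton]

/-- `[X^2](p · q) = p₀ q₂ + p₁ q₁ + p₂ q₀`. [cite: MadrasSlade1993, §1.1 eq. (1.1.8) p. 5; lane plumbing] -/
private theorem st_coeff_two_mul (p q : Polynomial ℚ) :
    (p * q).coeff 2 = p.coeff 0 * q.coeff 2 + p.coeff 1 * q.coeff 1 + p.coeff 2 * q.coeff 0 := by
  rw [Polynomial.coeff_mul, Finset.Nat.sum_antidiagonal_succ, Finset.Nat.sum_antidiagonal_succ,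
    Finset.Nat.antidiagonal_zero, Finset.sum_singleton]
  ring

/-- The second coefficient of a product: `[X^{m+m'}](P·Q·X) = [X^m]P · [X^{m'}](Q·X) + [X^m](P·X) · [X^{m'}]Q`.
[cite: MadrasSlade1993, §1.1 eq. (1.1.8) p. 5; lane plumbing] -/
private theorem st_coeff_mul_mul_X {P Q : Polynomial ℚ} {m m' : ℕ} (hP : P.natDegree ≤ m) (hQ : Q.natDegree ≤ m') :
    (P * Q * Polynomial.X).coeff (m + m') =
      P.coeff m * (Q * Polynomial.X).coeff m' + (P * Polynomial.X).coeff m * Q.coeff m' := by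
  have hPQ : (P * Q).natDegree ≤ m + m' := Polynomial.natDegree_mul_le.trans (add_le_add hP hQ)
  rw [← st_reflect_coeff_one hPQ, Polynomial.reflect_mul P Q hP hQ, st_coeff_one_mul, st_reflect_coeff_zero,
    st_reflect_coeff_zero, st_reflect_coeff_one hP, st_reflect_coeff_one hQ]

/-- The third coefficient of a product:
`[X^{m+m'}](P·Q·X²) = [X^m]P · [X^{m'}](Q·X²) + [X^m](P·X) · [X^{m'}](Q·X) + [X^m](P·X²) · [X^{m'}]Q`.
[cite: MadrasSlade1993, §1.1 eq. (1.1.8) p. 5; lane plumbing] -/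
private theorem st_coeff_mul_mul_X_sq {P Q : Polynomial ℚ} {m m' : ℕ} (hP : P.natDegree ≤ m) (hQ : Q.natDegree ≤ m') :
    (P * Q * Polynomial.X ^ 2).coeff (m + m') =
      P.coeff m * (Q * Polynomial.X ^ 2).coeff m' + (P * Polynomial.X).coeff m * (Q * Polynomial.X).coeff m' +
        (P * Polynomial.X ^ 2).coeff m * Q.coeff m' := by
  have hPQ : (P * Q).natDegree ≤ m + m' := Polynomial.natDegree_mul_le.trans (add_le_add hP hQ)
  rw [← st_reflect_coeff_two hPQ, Polynomial.reflect_mul P Q hP hQ, st_coeff_two_mul, st_reflect_coeff_zero,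
    st_reflect_coeff_zero, st_reflect_coeff_one hP, st_reflect_coeff_one hQ, st_reflect_coeff_two hP,
    st_reflect_coeff_two hQ]

/-! #### Symbol TRIPLES of polynomial-in-`d` functions
Inline predicate: `∃ P : ℚ[X], P.natDegree ≤ m ∧ P.coeff m = a ∧ (P * X).coeff m = b ∧ (P * X^2).coeff m = c ∧ ∀ d : ℕ, f d = P.eval d`
(`(P * X^2).coeff m` is `P.coeff (m − 2)` for `m ≥ 2` and `0` otherwise). -/

/-- Products: symbols `(a, b, c)·(a', b', c') = (aa', ab' + ba', ac' + bb' + ca')`. [cite: MadrasSlade1993, §1.1 eq. (1.1.8) p. 5; lane plumbing] -/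
private theorem gsc3_mul {f g : ℕ → ℚ} {m m' : ℕ} {a b c a' b' c' : ℚ}
    (hf : ∃ P : Polynomial ℚ, P.natDegree ≤ m ∧ P.coeff m = a ∧ (P * Polynomial.X).coeff m = b ∧
      (P * Polynomial.X ^ 2).coeff m = c ∧ ∀ d : ℕ, f d = P.eval (d : ℚ))
    (hg : ∃ P : Polynomial ℚ, P.natDegree ≤ m' ∧ P.coeff m' = a' ∧ (P * Polynomial.X).coeff m' = b' ∧
      (P * Polynomial.X ^ 2).coeff m' = c' ∧ ∀ d : ℕ, g d = P.eval (d : ℚ)) :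
    ∃ P : Polynomial ℚ, P.natDegree ≤ m + m' ∧ P.coeff (m + m') = a * a' ∧
      (P * Polynomial.X).coeff (m + m') = a * b' + b * a' ∧
      (P * Polynomial.X ^ 2).coeff (m + m') = a * c' + b * b' + c * a' ∧ ∀ d : ℕ, f d * g d = P.eval (d : ℚ) := by
  obtain ⟨P, hP, hPa, hPb, hPc, hf⟩ := hf
  obtain ⟨Q, hQ, hQa, hQb, hQc, hg⟩ := hg
  refine ⟨P * Q, Polynomial.natDegree_mul_le.trans (add_le_add hP hQ),
    by rw [Polynomial.coeff_mul_add_eq_of_natDegree_le hP hQ, hPa, hQa],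
    by rw [st_coeff_mul_mul_X hP hQ, hPa, hPb, hQa, hQb],
    by rw [st_coeff_mul_mul_X_sq hP hQ, hPa, hPb, hPc, hQa, hQb, hQc], fun d => by rw [hf, hg, Polynomial.eval_mul]⟩

/-- Differences. [cite: MadrasSlade1993, §1.1 eq. (1.1.8) p. 5; lane plumbing] -/
private theorem gsc3_sub {f g : ℕ → ℚ} {m : ℕ} {a b c a' b' c' : ℚ}
    (hf : ∃ P : Polynomial ℚ, P.natDegree ≤ m ∧ P.coeff m = a ∧ (P * Polynomial.X).coeff m = b ∧
      (P * Polynomial.X ^ 2).coeff m = c ∧ ∀ d : ℕ, f d = P.eval (d : ℚ))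
    (hg : ∃ P : Polynomial ℚ, P.natDegree ≤ m ∧ P.coeff m = a' ∧ (P * Polynomial.X).coeff m = b' ∧
      (P * Polynomial.X ^ 2).coeff m = c' ∧ ∀ d : ℕ, g d = P.eval (d : ℚ)) :
    ∃ P : Polynomial ℚ, P.natDegree ≤ m ∧ P.coeff m = a - a' ∧ (P * Polynomial.X).coeff m = b - b' ∧
      (P * Polynomial.X ^ 2).coeff m = c - c' ∧ ∀ d : ℕ, f d - g d = P.eval (d : ℚ) := by
  obtain ⟨P, hP, hPa, hPb, hPc, hf⟩ := hf
  obtain ⟨Q, hQ, hQa, hQb, hQc, hg⟩ := hg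
  exact ⟨P - Q, (Polynomial.natDegree_sub_le _ _).trans (max_le hP hQ), by rw [Polynomial.coeff_sub, hPa, hQa],
    by rw [sub_mul, Polynomial.coeff_sub, hPb, hQb], by rw [sub_mul, Polynomial.coeff_sub, hPc, hQc],
    fun d => by rw [hf, hg, Polynomial.eval_sub]⟩

/-- Finite sums. [cite: MadrasSlade1993, §1.1 eq. (1.1.8) p. 5; lane plumbing] -/
private theorem gsc3_sum {ι : Type*} (s : Finset ι) {f : ι → ℕ → ℚ} {m : ℕ} {a b c : ι → ℚ}
    (h : ∀ i ∈ s, ∃ P : Polynomial ℚ, P.natDegree ≤ m ∧ P.coeff m = a i ∧ (P * Polynomial.X).coeff m = b i ∧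
      (P * Polynomial.X ^ 2).coeff m = c i ∧ ∀ d : ℕ, f i d = P.eval (d : ℚ)) :
    ∃ P : Polynomial ℚ, P.natDegree ≤ m ∧ P.coeff m = ∑ i ∈ s, a i ∧ (P * Polynomial.X).coeff m = ∑ i ∈ s, b i ∧
      (P * Polynomial.X ^ 2).coeff m = ∑ i ∈ s, c i ∧ ∀ d : ℕ, (∑ i ∈ s, f i d) = P.eval (d : ℚ) := by
  classical
  induction s using Finset.induction_on with
  | empty => exact ⟨0, by simp, by simp, by simp, by simp, fun d => by simp⟩
  | @insert i s hi ih =>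
    obtain ⟨P, hP, hPa, hPb, hPc, hf⟩ := h i (Finset.mem_insert_self i s)
    obtain ⟨Q, hQ, hQa, hQb, hQc, hg⟩ := ih fun j hj => h j (Finset.mem_insert_of_mem hj)
    refine ⟨P + Q, (Polynomial.natDegree_add_le _ _).trans (max_le hP hQ), ?_, ?_, ?_, fun d => ?_⟩
    · rw [Polynomial.coeff_add, hPa, hQa, Finset.sum_insert hi]
    · rw [add_mul, Polynomial.coeff_add, hPb, hQb, Finset.sum_insert hi]
    · rw [add_mul, Polynomial.coeff_add, hPc, hQc, Finset.sum_insert hi]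
    · rw [Finset.sum_insert hi, hf, hg, Polynomial.eval_add]

/-- Pointwise-equal functions. [cite: MadrasSlade1993, §1.1 eq. (1.1.8) p. 5; lane plumbing] -/
private theorem gsc3_congr {f g : ℕ → ℚ} {m : ℕ} {a b c : ℚ} (hfg : ∀ d, f d = g d)
    (h : ∃ P : Polynomial ℚ, P.natDegree ≤ m ∧ P.coeff m = a ∧ (P * Polynomial.X).coeff m = b ∧
      (P * Polynomial.X ^ 2).coeff m = c ∧ ∀ d : ℕ, f d = P.eval (d : ℚ)) :
    ∃ P : Polynomial ℚ, P.natDegree ≤ m ∧ P.coeff m = a ∧ (P * Polynomial.X).coeff m = b ∧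
      (P * Polynomial.X ^ 2).coeff m = c ∧ ∀ d : ℕ, g d = P.eval (d : ℚ) := by
  obtain ⟨P, hP, hPa, hPb, hPc, hf⟩ := h
  exact ⟨P, hP, hPa, hPb, hPc, fun d => by rw [← hfg d, hf d]⟩

/-- Equal symbol values. [cite: MadrasSlade1993, §1.1 eq. (1.1.8) p. 5; lane plumbing] -/
private theorem gsc3_of_eq {f : ℕ → ℚ} {m : ℕ} {a b c a' b' c' : ℚ} (ha : a = a') (hb : b = b') (hc : c = c')
    (h : ∃ P : Polynomial ℚ, P.natDegree ≤ m ∧ P.coeff m = a ∧ (P * Polynomial.X).coeff m = b ∧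
      (P * Polynomial.X ^ 2).coeff m = c ∧ ∀ d : ℕ, f d = P.eval (d : ℚ)) :
    ∃ P : Polynomial ℚ, P.natDegree ≤ m ∧ P.coeff m = a' ∧ (P * Polynomial.X).coeff m = b' ∧
      (P * Polynomial.X ^ 2).coeff m = c' ∧ ∀ d : ℕ, f d = P.eval (d : ℚ) := by
  subst ha hb hc; exact h

/-- The zero function has every degree bound with symbols `(0, 0, 0)`. [cite: MadrasSlade1993, §1.1 eq. (1.1.8) p. 5; lane plumbing] -/
private theorem gsc3_zero (m : ℕ) :
    ∃ P : Polynomial ℚ, P.natDegree ≤ m ∧ P.coeff m = 0 ∧ (P * Polynomial.X).coeff m = 0 ∧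
      (P * Polynomial.X ^ 2).coeff m = 0 ∧ ∀ d : ℕ, (0 : ℚ) = P.eval (d : ℚ) :=
  ⟨0, by simp, by simp, by simp, by simp, fun d => by simp⟩

/-- Raising a too-generous degree bound by three kills the triple. [cite: MadrasSlade1993, §1.1 eq. (1.1.8) p. 5; lane plumbing] -/
private theorem gsc3_raise_three {f : ℕ → ℚ} {m m' : ℕ} (h : ∃ P : Polynomial ℚ, P.natDegree ≤ m ∧ ∀ d : ℕ, f d = P.eval (d : ℚ))
    (hm : m + 3 ≤ m') :
    ∃ P : Polynomial ℚ, P.natDegree ≤ m' ∧ P.coeff m' = 0 ∧ (P * Polynomial.X).coeff m' = 0 ∧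
      (P * Polynomial.X ^ 2).coeff m' = 0 ∧ ∀ d : ℕ, f d = P.eval (d : ℚ) := by
  obtain ⟨P, hP, hf⟩ := h
  have hPX : (P * Polynomial.X).natDegree ≤ m + 1 :=
    Polynomial.natDegree_mul_le.trans (by rw [Polynomial.natDegree_X]; omega)
  have hPX2 : (P * Polynomial.X ^ 2).natDegree ≤ m + 2 :=
    Polynomial.natDegree_mul_le.trans (by rw [Polynomial.natDegree_X_pow]; omega)
  exact ⟨P, hP.trans (by omega), Polynomial.coeff_eq_zero_of_natDegree_lt (by omega),
    Polynomial.coeff_eq_zero_of_natDegree_lt (by omega), Polynomial.coeff_eq_zero_of_natDegree_lt (by omega), hf⟩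

/-- A function of degree `≤ m` with top coefficient `a` has triple `(0, 0, a)` in degree `m + 2`.
[cite: MadrasSlade1993, §1.1 eq. (1.1.8) p. 5; lane plumbing] -/
private theorem gsc3_raise_two {f : ℕ → ℚ} {m : ℕ} {a : ℚ}
    (h : ∃ P : Polynomial ℚ, P.natDegree ≤ m ∧ P.coeff m = a ∧ ∀ d : ℕ, f d = P.eval (d : ℚ)) :
    ∃ P : Polynomial ℚ, P.natDegree ≤ m + 2 ∧ P.coeff (m + 2) = 0 ∧ (P * Polynomial.X).coeff (m + 2) = 0 ∧
      (P * Polynomial.X ^ 2).coeff (m + 2) = a ∧ ∀ d : ℕ, f d = P.eval (d : ℚ) := by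
  obtain ⟨P, hP, hPa, hf⟩ := h
  refine ⟨P, hP.trans (by omega), Polynomial.coeff_eq_zero_of_natDegree_lt (by omega), ?_, ?_, hf⟩
  · rw [Polynomial.coeff_mul_X]
    exact Polynomial.coeff_eq_zero_of_natDegree_lt (by omega)
  · rw [Polynomial.coeff_mul_X_pow, hPa]

/-! #### Families `d ↦ S_d ∈ ℤ[X]` with symbol TRIPLE `(σ, τ, υ)` up to order `K` -/

/-- The constant family `1` has symbol triple `(1, 0, 0)`. [cite: MadrasSlade1993, §1.1 eq. (1.1.8) p. 5; lane plumbing] -/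
private theorem gsym3_one (K : ℕ) : ∀ i ≤ K, ∃ P : Polynomial ℚ, P.natDegree ≤ i ∧ P.coeff i = (1 : Polynomial ℚ).coeff i ∧
    (P * Polynomial.X).coeff i = (0 : Polynomial ℚ).coeff i ∧ (P * Polynomial.X ^ 2).coeff i = (0 : Polynomial ℚ).coeff i ∧
    ∀ d : ℕ, ((((1 : Polynomial ℤ)).coeff i : ℤ) : ℚ) = P.eval (d : ℚ) := by
  intro i _
  by_cases hi : i = 0
  · subst hi
    refine ⟨1, by simp, by simp, ?_, ?_, fun d => by simp⟩
    · rw [one_mul, Polynomial.coeff_X_zero, Polynomial.coeff_zero]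
    · rw [one_mul, Polynomial.coeff_X_pow, Polynomial.coeff_zero, if_neg (by decide)]
  · refine ⟨0, by simp, by simp [Polynomial.coeff_one, hi], by simp, by simp, fun d => by simp [Polynomial.coeff_one, hi]⟩

/-- Products of families: symbol triples multiply as `(σ, τ, υ)(σ', τ', υ') = (σσ', στ' + τσ', συ' + ττ' + υσ')`.
[cite: MadrasSlade1993, §1.1 eq. (1.1.8) p. 5; lane plumbing] -/
private theorem gsym3_mul {S T : ℕ → Polynomial ℤ} {σ τ υ σ' τ' υ' : Polynomial ℚ} {K : ℕ}
    (hS : ∀ i ≤ K, ∃ P : Polynomial ℚ, P.natDegree ≤ i ∧ P.coeff i = σ.coeff i ∧ (P * Polynomial.X).coeff i = τ.coeff i ∧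
      (P * Polynomial.X ^ 2).coeff i = υ.coeff i ∧ ∀ d : ℕ, (((S d).coeff i : ℤ) : ℚ) = P.eval (d : ℚ))
    (hT : ∀ i ≤ K, ∃ P : Polynomial ℚ, P.natDegree ≤ i ∧ P.coeff i = σ'.coeff i ∧ (P * Polynomial.X).coeff i = τ'.coeff i ∧
      (P * Polynomial.X ^ 2).coeff i = υ'.coeff i ∧ ∀ d : ℕ, (((T d).coeff i : ℤ) : ℚ) = P.eval (d : ℚ)) :
    ∀ i ≤ K, ∃ P : Polynomial ℚ, P.natDegree ≤ i ∧ P.coeff i = (σ * σ').coeff i ∧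
      (P * Polynomial.X).coeff i = (σ * τ' + τ * σ').coeff i ∧
      (P * Polynomial.X ^ 2).coeff i = (σ * υ' + τ * τ' + υ * σ').coeff i ∧
      ∀ d : ℕ, (((S d * T d).coeff i : ℤ) : ℚ) = P.eval (d : ℚ) := by
  intro i hi
  have key : ∃ P : Polynomial ℚ, P.natDegree ≤ i ∧
      P.coeff i = ∑ x ∈ antidiagonal i, σ.coeff x.1 * σ'.coeff x.2 ∧
      (P * Polynomial.X).coeff i = ∑ x ∈ antidiagonal i, (σ.coeff x.1 * τ'.coeff x.2 + τ.coeff x.1 * σ'.coeff x.2) ∧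
      (P * Polynomial.X ^ 2).coeff i = ∑ x ∈ antidiagonal i,
        (σ.coeff x.1 * υ'.coeff x.2 + τ.coeff x.1 * τ'.coeff x.2 + υ.coeff x.1 * σ'.coeff x.2) ∧
      ∀ d : ℕ, (∑ x ∈ antidiagonal i, (((S d).coeff x.1 : ℚ)) * ((T d).coeff x.2 : ℚ)) = P.eval (d : ℚ) := by
    refine gsc3_sum _ fun x hx => ?_
    have hx' : x.1 + x.2 = i := mem_antidiagonal.1 hx
    have h := gsc3_mul (hS x.1 (by omega)) (hT x.2 (by omega))
    rwa [hx'] at h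
  obtain ⟨P, hP, hPa, hPb, hPc, h⟩ := key
  refine ⟨P, hP, by rw [hPa, Polynomial.coeff_mul], ?_, ?_, fun d => ?_⟩
  · rw [hPb, Polynomial.coeff_add, Polynomial.coeff_mul, Polynomial.coeff_mul, ← Finset.sum_add_distrib]
  · rw [hPc, Polynomial.coeff_add, Polynomial.coeff_add, Polynomial.coeff_mul, Polynomial.coeff_mul, Polynomial.coeff_mul,
      ← Finset.sum_add_distrib, ← Finset.sum_add_distrib]
  · rw [← h d, Polynomial.coeff_mul]
    push_cast
    rfl

/-- Powers of a family: symbol triple `(σ^n, n σ^{n−1} τ, n σ^{n−1} υ + C(n,2) σ^{n−2} τ²)`.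
[cite: MadrasSlade1993, §1.1 eq. (1.1.8) p. 5; lane plumbing] -/
private theorem gsym3_pow {S : ℕ → Polynomial ℤ} {σ τ υ : Polynomial ℚ} {K : ℕ}
    (hS : ∀ i ≤ K, ∃ P : Polynomial ℚ, P.natDegree ≤ i ∧ P.coeff i = σ.coeff i ∧ (P * Polynomial.X).coeff i = τ.coeff i ∧
      (P * Polynomial.X ^ 2).coeff i = υ.coeff i ∧ ∀ d : ℕ, (((S d).coeff i : ℤ) : ℚ) = P.eval (d : ℚ)) (n : ℕ) :
    ∀ i ≤ K, ∃ P : Polynomial ℚ, P.natDegree ≤ i ∧ P.coeff i = (σ ^ n).coeff i ∧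
      (P * Polynomial.X).coeff i = ((n : Polynomial ℚ) * σ ^ (n - 1) * τ).coeff i ∧
      (P * Polynomial.X ^ 2).coeff i =
        ((n : Polynomial ℚ) * σ ^ (n - 1) * υ + ((n.choose 2 : ℕ) : Polynomial ℚ) * σ ^ (n - 2) * τ ^ 2).coeff i ∧
      ∀ d : ℕ, ((((S d) ^ n).coeff i : ℤ) : ℚ) = P.eval (d : ℚ) := by
  induction n with
  | zero =>
    intro i hi
    obtain ⟨P, hP, hPa, hPb, hPc, h⟩ := gsym3_one K i hi
    refine ⟨P, hP, by rw [hPa, pow_zero], by rw [hPb]; simp, by rw [hPc]; simp, fun d => by rw [← h d, pow_zero]⟩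
  | succ n ih =>
    intro i hi
    obtain ⟨P, hP, hPa, hPb, hPc, h⟩ := gsym3_mul (S := fun d => S d ^ n) (T := S) ih hS i hi
    have hid : σ ^ n * τ + (n : Polynomial ℚ) * σ ^ (n - 1) * τ * σ = ((n + 1 : ℕ) : Polynomial ℚ) * σ ^ (n + 1 - 1) * τ := by
      rcases n with _ | k
      · simp
      · rw [Nat.add_sub_cancel, show k + 1 + 1 - 1 = k + 1 from rfl, pow_succ]; push_cast; ring
    have hid2 : σ ^ n * υ + (n : Polynomial ℚ) * σ ^ (n - 1) * τ * τ +
        ((n : Polynomial ℚ) * σ ^ (n - 1) * υ + ((n.choose 2 : ℕ) : Polynomial ℚ) * σ ^ (n - 2) * τ ^ 2) * σ =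
        ((n + 1 : ℕ) : Polynomial ℚ) * σ ^ (n + 1 - 1) * υ +
          (((n + 1).choose 2 : ℕ) : Polynomial ℚ) * σ ^ (n + 1 - 2) * τ ^ 2 := by
      rcases n with _ | k
      · simp
      · rcases k with _ | k
        · simp; ring
        · rw [show k + 1 + 1 - 1 = k + 1 by omega, show k + 1 + 1 - 2 = k by omega, show k + 1 + 1 + 1 - 1 = k + 1 + 1 by omega,
            show k + 1 + 1 + 1 - 2 = k + 1 by omega, Nat.choose_succ_succ' (k + 1 + 1) 1, Nat.choose_one_right,
            pow_succ, pow_succ]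
          push_cast; ring
    refine ⟨P, hP, by rw [hPa, pow_succ], by rw [hPb, hid], by rw [hPc, hid2], fun d => by rw [← h d, pow_succ]⟩

/-- Differences of families. [cite: MadrasSlade1993, §1.1 eq. (1.1.8) p. 5; lane plumbing] -/
private theorem gsym3_sub {S T : ℕ → Polynomial ℤ} {σ τ υ σ' τ' υ' : Polynomial ℚ} {K : ℕ}
    (hS : ∀ i ≤ K, ∃ P : Polynomial ℚ, P.natDegree ≤ i ∧ P.coeff i = σ.coeff i ∧ (P * Polynomial.X).coeff i = τ.coeff i ∧
      (P * Polynomial.X ^ 2).coeff i = υ.coeff i ∧ ∀ d : ℕ, (((S d).coeff i : ℤ) : ℚ) = P.eval (d : ℚ))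
    (hT : ∀ i ≤ K, ∃ P : Polynomial ℚ, P.natDegree ≤ i ∧ P.coeff i = σ'.coeff i ∧ (P * Polynomial.X).coeff i = τ'.coeff i ∧
      (P * Polynomial.X ^ 2).coeff i = υ'.coeff i ∧ ∀ d : ℕ, (((T d).coeff i : ℤ) : ℚ) = P.eval (d : ℚ)) :
    ∀ i ≤ K, ∃ P : Polynomial ℚ, P.natDegree ≤ i ∧ P.coeff i = (σ - σ').coeff i ∧
      (P * Polynomial.X).coeff i = (τ - τ').coeff i ∧ (P * Polynomial.X ^ 2).coeff i = (υ - υ').coeff i ∧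
      ∀ d : ℕ, (((S d - T d).coeff i : ℤ) : ℚ) = P.eval (d : ℚ) := by
  intro i hi
  obtain ⟨P, hP, hPa, hPb, hPc, h⟩ := gsc3_sub (hS i hi) (hT i hi)
  refine ⟨P, hP, by rw [hPa, Polynomial.coeff_sub], by rw [hPb, Polynomial.coeff_sub], by rw [hPc, Polynomial.coeff_sub],
    fun d => ?_⟩
  rw [← h d, Polynomial.coeff_sub]
  push_cast
  rfl

/-- Finite sums of families. [cite: MadrasSlade1993, §1.1 eq. (1.1.8) p. 5; lane plumbing] -/
private theorem gsym3_sum {ι : Type*} (s : Finset ι) {S : ι → ℕ → Polynomial ℤ} {σ τ υ : ι → Polynomial ℚ} {K : ℕ}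
    (hS : ∀ j ∈ s, ∀ i ≤ K, ∃ P : Polynomial ℚ, P.natDegree ≤ i ∧ P.coeff i = (σ j).coeff i ∧
      (P * Polynomial.X).coeff i = (τ j).coeff i ∧ (P * Polynomial.X ^ 2).coeff i = (υ j).coeff i ∧
      ∀ d : ℕ, (((S j d).coeff i : ℤ) : ℚ) = P.eval (d : ℚ)) :
    ∀ i ≤ K, ∃ P : Polynomial ℚ, P.natDegree ≤ i ∧ P.coeff i = (∑ j ∈ s, σ j).coeff i ∧
      (P * Polynomial.X).coeff i = (∑ j ∈ s, τ j).coeff i ∧ (P * Polynomial.X ^ 2).coeff i = (∑ j ∈ s, υ j).coeff i ∧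
      ∀ d : ℕ, (((∑ j ∈ s, S j d).coeff i : ℤ) : ℚ) = P.eval (d : ℚ) := by
  intro i hi
  obtain ⟨P, hP, hPa, hPb, hPc, h⟩ := gsc3_sum s (fun j hj => hS j hj i hi)
  refine ⟨P, hP, by rw [hPa, Polynomial.finsetSum_coeff], by rw [hPb, Polynomial.finsetSum_coeff],
    by rw [hPc, Polynomial.finsetSum_coeff], fun d => ?_⟩
  rw [← h d, Polynomial.finsetSum_coeff]
  push_cast
  rfl

end Symbol3



/-! ### The symbol triple of the cost census -/

section Census

/-- ★ THE SPAN-TWO CELL: for `c ≥ 2`, `d ↦ N_{c,c+2}(ℤ^{d+1})` is a polynomial of degree `≤ c − 2` whose `d^{c−2}`-coefficient is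
`C(c−1,3) · 2^{c−2}` — the axis-class identity, the degree profile (classes above `u = c − 2` are empty) and the count
`F_{c,c+2}(c−2) = 2^{c−2}(c−2)!C(c−1,3)` of the one-down-step class (`SAWIrreducibleBridgeSpanTwoTopClassCount`).
[cite: MadrasSlade1993, §1.1 eq. (1.1.8) p. 5; §4.2 eq. (4.2.20)–(4.2.22); lane theorem] -/
theorem exists_polynomial_costCoeffZd_spanTwo (m : ℕ) :
    ∃ P : Polynomial ℚ, P.natDegree ≤ m ∧ P.coeff m = ((m + 1).choose 3 : ℕ) * (2 : ℚ) ^ m ∧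
      ∀ d : ℕ, (costCoeffZd d (m + 2) (m + 4) : ℚ) = P.eval (d : ℚ) := by
  classical
  set F : ℕ → ℕ := fun u => ((irreducibleBridges (u + 1) (m + 4)).filter fun (ω : ℕ → Site (u + 1)) =>
      costZd u (m + 4) ω = m + 2 ∧ ∀ a : Fin (u + 1), a ≠ 0 → ∃ i ≤ m + 4, ω i a ≠ (0 : ℤ)).card with hF
  have hNF : ∀ d, costCoeffZd d (m + 2) (m + 4) = ∑ u ∈ Finset.range (m + 2 + 1), d.choose u * F u := fun d =>
    costCoeffZd_eq_sum_choose_mul d (m + 2) (m + 4)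
  have hFz : ∀ u, m < u → F u = 0 := by
    intro u hu
    rw [hF]
    exact card_allAxesClass_eq_zero_of_lt (by omega)
  have hFm : (F m : ℚ) = 2 ^ m * m.factorial * (m + 1).choose 3 := by
    rw [hF]
    exact_mod_cast card_spanTwoTopClass m
  refine ⟨∑ u ∈ Finset.range (m + 2 + 1), Polynomial.C ((F u : ℚ) / (u.factorial : ℚ)) * descPochhammer ℚ u, ?_, ?_, ?_⟩
  · refine Polynomial.natDegree_sum_le_of_forall_le _ _ fun u _ => ?_
    by_cases hu : m < u
    · rw [hFz u hu]; simp
    · calc (Polynomial.C ((F u : ℚ) / (u.factorial : ℚ)) * descPochhammer ℚ u).natDegree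
          ≤ (descPochhammer ℚ u).natDegree := Polynomial.natDegree_C_mul_le _ _
        _ = u := descPochhammer_natDegree ℚ u
        _ ≤ m := by omega
  · rw [Polynomial.finsetSum_coeff, Finset.sum_eq_single_of_mem m (Finset.mem_range.2 (by omega))]
    · rw [Polynomial.coeff_C_mul]
      have hmon : (descPochhammer ℚ m).coeff m = 1 := by
        have h := (monic_descPochhammer ℚ m).coeff_natDegree
        rwa [descPochhammer_natDegree] at h
      rw [hmon, mul_one, hFm]
      have hf : (m.factorial : ℚ) ≠ 0 := by exact_mod_cast m.factorial_ne_zero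
      field_simp
    · intro u hu hum
      rw [Polynomial.coeff_C_mul]
      by_cases hlt : m < u
      · rw [hFz u hlt]; simp
      · rw [Polynomial.coeff_eq_zero_of_natDegree_lt, mul_zero]
        rw [descPochhammer_natDegree]
        omega
  · intro d
    rw [hNF d, Polynomial.eval_finsetSum]
    push_cast
    refine Finset.sum_congr rfl fun u _ => ?_
    have hf : (u.factorial : ℚ) ≠ 0 := by exact_mod_cast u.factorial_ne_zero
    rw [Polynomial.eval_mul, Polynomial.eval_C, descPochhammer_eval_eq_descFactorial ℚ d u,
      Nat.descFactorial_eq_factorial_mul_choose, Nat.cast_mul, div_mul_eq_mul_div, mul_div_assoc,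
      mul_div_cancel_left₀ _ hf, mul_comm]

/-- ★★ THE THIRD SYMBOL OF THE COST CENSUS: for `c ≥ 1`, `d ↦ N_{c,n}(ℤ^{d+1})` is a polynomial of degree `≤ c` whose `d^c`-, `d^{c−1}`-
and `d^{c−2}`-coefficients (the latter two carried as `[X^c](P·X)`, `[X^c](P·X²)`) are: on the span-one cell `n = c + 1` (where
`N_{c,c+1}(ℤ^{d+1}) = c_c(ℤ^d)`): `2^c`, `−(c−1)2^{c−1}` and the third coefficient of `c_c(ℤ^d)` — `2^{c−3}(c² − 5c + 8)` for `c ≥ 3`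
(`SAWCountZdThirdCoefficient`), `0` for `c = 1, 2` (`c₁ = 2d`, `c₂ = 4d² − 2d`); on the span-two cell `n = c + 2`: `0, 0, C(c−1,3)·2^{c−2}`
(`exists_polynomial_costCoeffZd_spanTwo`); and `0, 0, 0` on every other cell (`n ≤ c`: empty; `n ≥ c + 3`: empty or of degree
`≤ 3c + 2 − 2n ≤ c − 4`). [cite: MadrasSlade1993, §1.1 eq. (1.1.8) p. 5; §4.2 eq. (4.2.20)–(4.2.22); lane theorem] -/
theorem exists_polynomial_costCoeffZd_topThree {c : ℕ} (hc : 1 ≤ c) (n : ℕ) :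
    ∃ P : Polynomial ℚ, P.natDegree ≤ c ∧ P.coeff c = (if n = c + 1 then (2 : ℚ) ^ c else 0) ∧
      (P * Polynomial.X).coeff c = (if n = c + 1 then -((c : ℚ) - 1) * 2 ^ (c - 1) else 0) ∧
      (P * Polynomial.X ^ 2).coeff c =
        (if n = c + 1 then (if 3 ≤ c then (2 : ℚ) ^ (c - 3) * ((c : ℚ) ^ 2 - 5 * c + 8) else 0)
          else if n = c + 2 then (((c - 1).choose 3 : ℕ) : ℚ) * 2 ^ (c - 2) else 0) ∧
      ∀ d : ℕ, (costCoeffZd d c n : ℚ) = P.eval (d : ℚ) := by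
  by_cases hn : n = c + 1
  · subst hn
    rw [if_pos rfl, if_pos rfl, if_pos rfl]
    by_cases h3 : 3 ≤ c
    · rw [if_pos h3]
      obtain ⟨P, hP, ha, hb, hcc, hev⟩ := exists_polynomial_count_topThree h3
      refine ⟨P, hP, ha, ?_, ?_, fun d => by rw [costCoeffZd_self_succ]; exact hev d⟩
      · obtain ⟨m, rfl⟩ : ∃ m, c = m + 1 := ⟨c - 1, by omega⟩
        rw [Polynomial.coeff_mul_X, Nat.add_sub_cancel] at *
        rw [hb]
      · obtain ⟨m, rfl⟩ : ∃ m, c = m + 2 := ⟨c - 2, by omega⟩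
        rw [Polynomial.coeff_mul_X_pow, Nat.add_sub_cancel] at *
        rw [hcc]
    · rw [if_neg h3]
      rcases Nat.lt_or_ge c 2 with hc1 | hc2
      · -- `c = 1`: `N_{1,2} = c₁(ℤ^d) = 2d`
        obtain rfl : c = 1 := by omega
        refine ⟨Polynomial.C 2 * Polynomial.X, ?_, ?_, ?_, ?_, fun d => ?_⟩
        · exact (Polynomial.natDegree_C_mul_le _ _).trans (by simp)
        · rw [Polynomial.coeff_C_mul, Polynomial.coeff_X_one]; norm_num
        · rw [mul_assoc, Polynomial.coeff_C_mul, ← pow_two, Polynomial.coeff_X_pow]; norm_num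
        · rw [mul_assoc, Polynomial.coeff_C_mul, ← pow_succ', Polynomial.coeff_X_pow]; norm_num
        · rw [costCoeffZd_self_succ, count_one_eq_two_mul]
          simp
      · -- `c = 2`: `N_{2,3} = c₂(ℤ^d) = 4d² − 2d`
        obtain rfl : c = 2 := by omega
        refine ⟨Polynomial.C 4 * Polynomial.X ^ 2 - Polynomial.C 2 * Polynomial.X, ?_, ?_, ?_, ?_, fun d => ?_⟩
        · refine (Polynomial.natDegree_sub_le _ _).trans (max_le ?_ ?_)
          · exact (Polynomial.natDegree_C_mul_le _ _).trans (by simp)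
          · exact (Polynomial.natDegree_C_mul_le _ _).trans (by simp)
        · rw [Polynomial.coeff_sub, Polynomial.coeff_C_mul, Polynomial.coeff_C_mul, Polynomial.coeff_X_pow, Polynomial.coeff_X]
          norm_num
        · rw [sub_mul, Polynomial.coeff_sub, mul_assoc, mul_assoc, Polynomial.coeff_C_mul, Polynomial.coeff_C_mul, ← pow_succ,
            ← pow_two, Polynomial.coeff_X_pow, Polynomial.coeff_X_pow]
          norm_num
        · rw [sub_mul, Polynomial.coeff_sub, mul_assoc, mul_assoc, Polynomial.coeff_C_mul, Polynomial.coeff_C_mul, ← pow_add,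
            ← pow_succ', Polynomial.coeff_X_pow, Polynomial.coeff_X_pow]
          norm_num
        · rw [costCoeffZd_self_succ, count_two_eq]
          have h1 : 1 ≤ 2 * d ∨ d = 0 := by omega
          rcases h1 with h1 | rfl
          · push_cast [Nat.cast_sub h1]
            simp
            ring
          · simp
  · rw [if_neg hn, if_neg hn, if_neg hn]
    by_cases hn2 : n = c + 2
    · subst hn2
      rw [if_pos rfl]
      rcases Nat.lt_or_ge c 2 with hc1 | hc2
      · -- `c = 1`, `n = 3`: empty cell
        obtain rfl : c = 1 := by omega
        refine ⟨0, by simp, by simp, by simp, by simp, fun d => ?_⟩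
        rw [costCoeffZd_eq_zero_of_lt (by norm_num : 3 * 1 + 2 < 2 * (1 + 2))]; simp
      · obtain ⟨m, rfl⟩ : ∃ m, c = m + 2 := ⟨c - 2, by omega⟩
        obtain ⟨P, hP, hPm, hev⟩ := exists_polynomial_costCoeffZd_spanTwo m
        rw [show m + 2 - 1 = m + 1 by omega, Nat.add_sub_cancel]
        exact gsc3_raise_two ⟨P, hP, hPm, hev⟩
    · rw [if_neg hn2]
      rcases Nat.lt_or_ge n (c + 1) with hlt | hge
      · -- `n ≤ c`: the cell is empty
        refine ⟨0, by simp, by simp, by simp, by simp, fun d => ?_⟩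
        rw [costCoeffZd_eq_zero_of_le (by omega : n ≤ c)]; simp
      · -- `n ≥ c + 3`
        rcases Nat.lt_or_ge (3 * c + 2) (2 * n) with hempty | hdeg
        · refine ⟨0, by simp, by simp, by simp, by simp, fun d => ?_⟩
          rw [costCoeffZd_eq_zero_of_lt hempty]; simp
        · obtain ⟨P, hP, hev⟩ := exists_polynomial_costCoeffZd_degree_profile c n
          exact gsc3_raise_three ⟨P, hP, hev⟩ (by omega)

end Census

/-! ### The symbol triples of the approximants `A_K`: one recursion step -/

section Engine

/-- ★ One recursion step on symbol TRIPLES: if the family `d ↦ A_K(N(ℤ^{d+1}))` has symbol triple `(σ, τ, υ)` up to order `K`, then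
`A_{K+1} = 1 − Σ_{c ≤ K+1} X^c P_c(A_K)` has, up to order `K + 1`, the top and second symbols of `SAWPulledLargeForceExpansionZdSecondSymbol`
and the THIRD symbol `−Σ_{c=1}^{K+1} X^c (2^c ((c+1) σ^c υ + C(c+1,2) σ^{c−1} τ²) − (c−1)2^{c−1} (c+1) σ^c τ + t₃(c) σ^{c+1} + s₂(c) σ^{c+2})`,
where `t₃(c) = 2^{c−3}(c² − 5c + 8)` (`c ≥ 3`; `0` for `c = 1, 2`) and `s₂(c) = C(c−1,3) 2^{c−2}` are the third census symbols of the
span-one and span-two cells (written below with `c = j + 1`). [cite: MadrasSlade1993, §1.1 eq. (1.1.8) p. 5; lane lemma] -/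
private theorem gsym3_A_succ {K : ℕ} {σ τ υ : Polynomial ℚ}
    (hA : ∀ i ≤ K, ∃ P : Polynomial ℚ, P.natDegree ≤ i ∧ P.coeff i = σ.coeff i ∧ (P * Polynomial.X).coeff i = τ.coeff i ∧
      (P * Polynomial.X ^ 2).coeff i = υ.coeff i ∧
      ∀ d : ℕ, (((CostSeries.A (costCoeffZd d) K).coeff i : ℤ) : ℚ) = P.eval (d : ℚ)) :
    ∀ i ≤ K + 1, ∃ P : Polynomial ℚ, P.natDegree ≤ i ∧
      P.coeff i = (1 - ∑ j ∈ Finset.range (K + 1), Polynomial.C ((2 : ℚ) ^ (j + 1)) * Polynomial.X ^ (j + 1) * σ ^ (j + 2)).coeff i ∧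
      (P * Polynomial.X).coeff i = (0 - ∑ j ∈ Finset.range (K + 1), Polynomial.X ^ (j + 1) *
        (Polynomial.C ((2 : ℚ) ^ (j + 1)) * (((j + 2 : ℕ) : Polynomial ℚ) * σ ^ (j + 1) * τ) -
          Polynomial.C ((j : ℚ) * 2 ^ j) * σ ^ (j + 2))).coeff i ∧
      (P * Polynomial.X ^ 2).coeff i = (0 - ∑ j ∈ Finset.range (K + 1), Polynomial.X ^ (j + 1) *
        (Polynomial.C ((2 : ℚ) ^ (j + 1)) * (((j + 2 : ℕ) : Polynomial ℚ) * σ ^ (j + 1) * υ +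
            (((j + 2).choose 2 : ℕ) : Polynomial ℚ) * σ ^ j * τ ^ 2) -
          Polynomial.C ((j : ℚ) * 2 ^ j) * (((j + 2 : ℕ) : Polynomial ℚ) * σ ^ (j + 1) * τ) +
          Polynomial.C (if 2 ≤ j then (2 : ℚ) ^ (j - 2) * ((j : ℚ) ^ 2 - 3 * j + 4) else 0) * σ ^ (j + 2) +
          Polynomial.C (((j.choose 3 : ℕ) : ℚ) * 2 ^ (j - 1)) * σ ^ (j + 3))).coeff i ∧
      ∀ d : ℕ, (((CostSeries.A (costCoeffZd d) (K + 1)).coeff i : ℤ) : ℚ) = P.eval (d : ℚ) := by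
  intro i hi
  -- each term `X^{j+1} · P_{j+1}(A_K)`
  have hterm : ∀ j ∈ Finset.range (K + 1), ∃ P : Polynomial ℚ, P.natDegree ≤ i ∧
      P.coeff i = (Polynomial.C ((2 : ℚ) ^ (j + 1)) * Polynomial.X ^ (j + 1) * σ ^ (j + 2)).coeff i ∧
      (P * Polynomial.X).coeff i = (Polynomial.X ^ (j + 1) *
        (Polynomial.C ((2 : ℚ) ^ (j + 1)) * (((j + 2 : ℕ) : Polynomial ℚ) * σ ^ (j + 1) * τ) -
          Polynomial.C ((j : ℚ) * 2 ^ j) * σ ^ (j + 2))).coeff i ∧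
      (P * Polynomial.X ^ 2).coeff i = (Polynomial.X ^ (j + 1) *
        (Polynomial.C ((2 : ℚ) ^ (j + 1)) * (((j + 2 : ℕ) : Polynomial ℚ) * σ ^ (j + 1) * υ +
            (((j + 2).choose 2 : ℕ) : Polynomial ℚ) * σ ^ j * τ ^ 2) -
          Polynomial.C ((j : ℚ) * 2 ^ j) * (((j + 2 : ℕ) : Polynomial ℚ) * σ ^ (j + 1) * τ) +
          Polynomial.C (if 2 ≤ j then (2 : ℚ) ^ (j - 2) * ((j : ℚ) ^ 2 - 3 * j + 4) else 0) * σ ^ (j + 2) +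
          Polynomial.C (((j.choose 3 : ℕ) : ℚ) * 2 ^ (j - 1)) * σ ^ (j + 3))).coeff i ∧ ∀ d : ℕ,
      (((Polynomial.X ^ (j + 1) * (CostSeries.Pz (costCoeffZd d) (j + 1)).comp (CostSeries.A (costCoeffZd d) K)).coeff i : ℤ) : ℚ) =
        P.eval (d : ℚ) := by
    intro j _
    have hcoef : (Polynomial.C ((2 : ℚ) ^ (j + 1)) * Polynomial.X ^ (j + 1) * σ ^ (j + 2)).coeff i =
        if j + 1 ≤ i then (2 : ℚ) ^ (j + 1) * (σ ^ (j + 2)).coeff (i - (j + 1)) else 0 := by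
      rw [mul_assoc, Polynomial.coeff_C_mul, Polynomial.coeff_X_pow_mul']
      split_ifs <;> simp
    have hcoef2 : (Polynomial.X ^ (j + 1) * (Polynomial.C ((2 : ℚ) ^ (j + 1)) * (((j + 2 : ℕ) : Polynomial ℚ) * σ ^ (j + 1) * τ) -
          Polynomial.C ((j : ℚ) * 2 ^ j) * σ ^ (j + 2))).coeff i =
        if j + 1 ≤ i then (2 : ℚ) ^ (j + 1) * ((((j + 2 : ℕ) : Polynomial ℚ) * σ ^ (j + 1) * τ)).coeff (i - (j + 1)) -
          ((j : ℚ) * 2 ^ j) * (σ ^ (j + 2)).coeff (i - (j + 1)) else 0 := by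
      rw [Polynomial.coeff_X_pow_mul']
      split_ifs
      · rw [Polynomial.coeff_sub, Polynomial.coeff_C_mul, Polynomial.coeff_C_mul]
      · rfl
    have hcoef3 : (Polynomial.X ^ (j + 1) *
        (Polynomial.C ((2 : ℚ) ^ (j + 1)) * (((j + 2 : ℕ) : Polynomial ℚ) * σ ^ (j + 1) * υ +
            (((j + 2).choose 2 : ℕ) : Polynomial ℚ) * σ ^ j * τ ^ 2) -
          Polynomial.C ((j : ℚ) * 2 ^ j) * (((j + 2 : ℕ) : Polynomial ℚ) * σ ^ (j + 1) * τ) +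
          Polynomial.C (if 2 ≤ j then (2 : ℚ) ^ (j - 2) * ((j : ℚ) ^ 2 - 3 * j + 4) else 0) * σ ^ (j + 2) +
          Polynomial.C (((j.choose 3 : ℕ) : ℚ) * 2 ^ (j - 1)) * σ ^ (j + 3))).coeff i =
        if j + 1 ≤ i then
          (2 : ℚ) ^ (j + 1) * ((((j + 2 : ℕ) : Polynomial ℚ) * σ ^ (j + 1) * υ +
            (((j + 2).choose 2 : ℕ) : Polynomial ℚ) * σ ^ j * τ ^ 2)).coeff (i - (j + 1)) -
          ((j : ℚ) * 2 ^ j) * ((((j + 2 : ℕ) : Polynomial ℚ) * σ ^ (j + 1) * τ)).coeff (i - (j + 1)) +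
          (if 2 ≤ j then (2 : ℚ) ^ (j - 2) * ((j : ℚ) ^ 2 - 3 * j + 4) else 0) * (σ ^ (j + 2)).coeff (i - (j + 1)) +
          (((j.choose 3 : ℕ) : ℚ) * 2 ^ (j - 1)) * (σ ^ (j + 3)).coeff (i - (j + 1)) else 0 := by
      rw [Polynomial.coeff_X_pow_mul']
      by_cases hji : j + 1 ≤ i
      · rw [if_pos hji, if_pos hji, Polynomial.coeff_add, Polynomial.coeff_add, Polynomial.coeff_sub, Polynomial.coeff_C_mul,
          Polynomial.coeff_C_mul, Polynomial.coeff_C_mul, Polynomial.coeff_C_mul]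
      · rw [if_neg hji, if_neg hji]
    by_cases hji : j + 1 ≤ i
    · -- `[X^{i-(j+1)}] P_{j+1}(A_K) = Σ_n N_{j+1,n} · [X^{i-(j+1)}] A_K^n`
      have hsum : ∃ P : Polynomial ℚ, P.natDegree ≤ i ∧
          P.coeff i = ∑ n ∈ Finset.range (2 * (j + 1) + 2),
            (if n = (j + 1) + 1 then (2 : ℚ) ^ (j + 1) else 0) * (σ ^ n).coeff (i - (j + 1)) ∧
          (P * Polynomial.X).coeff i = ∑ n ∈ Finset.range (2 * (j + 1) + 2),
            ((if n = (j + 1) + 1 then (2 : ℚ) ^ (j + 1) else 0) * (((n : Polynomial ℚ) * σ ^ (n - 1) * τ)).coeff (i - (j + 1)) +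
              (if n = (j + 1) + 1 then -(((j + 1 : ℕ) : ℚ) - 1) * 2 ^ (j + 1 - 1) else 0) * (σ ^ n).coeff (i - (j + 1))) ∧
          (P * Polynomial.X ^ 2).coeff i = ∑ n ∈ Finset.range (2 * (j + 1) + 2),
            ((if n = (j + 1) + 1 then (2 : ℚ) ^ (j + 1) else 0) *
                (((n : Polynomial ℚ) * σ ^ (n - 1) * υ + ((n.choose 2 : ℕ) : Polynomial ℚ) * σ ^ (n - 2) * τ ^ 2)).coeff (i - (j + 1)) +
              (if n = (j + 1) + 1 then -(((j + 1 : ℕ) : ℚ) - 1) * 2 ^ (j + 1 - 1) else 0) *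
                (((n : Polynomial ℚ) * σ ^ (n - 1) * τ)).coeff (i - (j + 1)) +
              (if n = (j + 1) + 1 then (if 3 ≤ j + 1 then (2 : ℚ) ^ (j + 1 - 3) * (((j + 1 : ℕ) : ℚ) ^ 2 - 5 * ((j + 1 : ℕ) : ℚ) + 8) else 0)
                else if n = (j + 1) + 2 then ((((j + 1) - 1).choose 3 : ℕ) : ℚ) * 2 ^ ((j + 1) - 2) else 0) *
                (σ ^ n).coeff (i - (j + 1))) ∧ ∀ d : ℕ,
          (∑ n ∈ Finset.range (2 * (j + 1) + 2),
            (costCoeffZd d (j + 1) n : ℚ) * (((CostSeries.A (costCoeffZd d) K ^ n).coeff (i - (j + 1)) : ℤ) : ℚ)) =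
            P.eval (d : ℚ) := by
        refine gsc3_sum _ fun n _ => ?_
        have h := gsc3_mul (exists_polynomial_costCoeffZd_topThree (Nat.succ_pos j) n)
          (gsym3_pow hA n (i - (j + 1)) (by omega))
        rwa [show j + 1 + (i - (j + 1)) = i by omega] at h
      obtain ⟨P, hP, hPa, hPb, hPc, h⟩ := hsum
      refine ⟨P, hP, ?_, ?_, ?_, fun d => ?_⟩
      · rw [hPa, hcoef, if_pos hji, Finset.sum_eq_single_of_mem ((j + 1) + 1)
          (Finset.mem_range.2 (by omega)) (fun n _ hn => by rw [if_neg hn, zero_mul]), if_pos rfl]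
      · rw [hPb, hcoef2, if_pos hji, Finset.sum_eq_single_of_mem ((j + 1) + 1)
          (Finset.mem_range.2 (by omega)) (fun n _ hn => by rw [if_neg hn, if_neg hn, zero_mul, zero_mul, add_zero]),
          if_pos rfl, if_pos rfl, Nat.add_sub_cancel, Nat.add_sub_cancel, show j + 1 + 1 = j + 2 from rfl]
        push_cast
        ring
      · rw [hPc, hcoef3, if_pos hji, Finset.sum_eq_add_of_mem ((j + 1) + 1) ((j + 1) + 2)
          (Finset.mem_range.2 (by omega)) (Finset.mem_range.2 (by omega)) (by omega)
          (fun n _ hn => by rw [if_neg hn.1, if_neg hn.1, if_neg hn.1, if_neg hn.2, zero_mul, zero_mul, zero_mul, add_zero, add_zero]),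
          if_pos rfl, if_pos rfl, if_pos rfl, if_neg (by omega : (j + 1) + 2 ≠ (j + 1) + 1),
          if_neg (by omega : (j + 1) + 2 ≠ (j + 1) + 1), if_neg (by omega : (j + 1) + 2 ≠ (j + 1) + 1), if_pos rfl,
          Nat.add_sub_cancel, Nat.add_sub_cancel, show j + 1 + 1 = j + 2 from rfl, show j + 1 + 2 = j + 3 from rfl,
          show j + 2 - 2 = j from rfl, show j + 1 - 3 = j - 2 by omega, show j + 1 - 2 = j - 1 by omega]
        have h3 : (if 3 ≤ j + 1 then (2 : ℚ) ^ (j - 2) * (((j + 1 : ℕ) : ℚ) ^ 2 - 5 * ((j + 1 : ℕ) : ℚ) + 8) else 0) =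
            (if 2 ≤ j then (2 : ℚ) ^ (j - 2) * ((j : ℚ) ^ 2 - 3 * j + 4) else 0) := by
          by_cases h2 : 2 ≤ j
          · rw [if_pos (by omega), if_pos h2]; push_cast; ring
          · rw [if_neg (by omega), if_neg h2]
        rw [h3]
        push_cast
        ring
      · rw [Polynomial.coeff_X_pow_mul', if_pos hji, ← h d, CostSeries.Pz, Polynomial.sum_comp, Polynomial.finsetSum_coeff]
        push_cast
        refine Finset.sum_congr rfl fun n _ => ?_
        rw [Polynomial.mul_comp, Polynomial.C_comp, Polynomial.X_pow_comp, Polynomial.coeff_C_mul]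
        push_cast
        rfl
    · refine ⟨0, by simp, by rw [hcoef, if_neg hji]; simp, by rw [hcoef2, if_neg hji]; simp, by rw [hcoef3, if_neg hji]; simp,
        fun d => ?_⟩
      rw [Polynomial.coeff_X_pow_mul', if_neg hji]
      simp
  have hsum := gsc3_sum (Finset.range (K + 1)) hterm
  obtain ⟨P, hP, hPa, hPb, hPc, h⟩ := gsc3_sub ((gsym3_one (K + 1)) i hi) hsum
  refine ⟨P, hP, ?_, ?_, ?_, fun d => ?_⟩
  · rw [hPa, Polynomial.coeff_sub, Polynomial.finsetSum_coeff]
  · rw [hPb, Polynomial.coeff_sub, Polynomial.finsetSum_coeff]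
  · rw [hPc, Polynomial.coeff_sub, Polynomial.finsetSum_coeff]
  · rw [← h d, CostSeries.A, Polynomial.coeff_sub, Polynomial.finsetSum_coeff]
    push_cast
    rfl

end Engine


/-! ### The symbol recursion solved at THIRD order in `ℚ⟦X⟧`

Conventions: `ι := Σ_i (−2)^i X^i = (1 + 2X)⁻¹`, `w := 2Xι = 1 − ι`, `θ := 2X²ι³` (the second-symbol limit of
`SAWPulledLargeForceExpansionZdSecondSymbol`) and the THIRD-symbol limit `κ := −2X³(1 − 2X + 4X²)ι⁵ = −(w³/4)(ι² − wι + w²)`. -/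

section Algebra3

/-- `(1 + 2X) · Σ_i (−2)^i X^i = 1` in `ℚ⟦X⟧`. [cite: MadrasSlade1993, §1.1 eq. (1.1.8) p. 5; lane plumbing] -/
private theorem alg3_iota_mul :
    (1 + PowerSeries.C (2 : ℚ) * PowerSeries.X) * PowerSeries.mk (fun i : ℕ => (-2 : ℚ) ^ i) = 1 := by
  ext n
  rw [add_mul, one_mul, map_add, PowerSeries.coeff_mk, mul_assoc, PowerSeries.coeff_C_mul, PowerSeries.coeff_one]
  rcases n with _ | n
  · rw [PowerSeries.coeff_zero_X_mul, mul_zero, add_zero, pow_zero, if_pos rfl]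
  · rw [PowerSeries.coeff_succ_X_mul, PowerSeries.coeff_mk, if_neg (Nat.succ_ne_zero n), pow_succ]
    ring

/-- `2·C(j,2) = j(j−1)` as an identity of casts. [cite: MadrasSlade1993, §1.1 eq. (1.1.8) p. 5; lane plumbing] -/
private theorem alg3_two_mul_cast_choose_two (j : ℕ) :
    (2 : PowerSeries ℚ) * ((j.choose 2 : ℕ) : PowerSeries ℚ) = (j : PowerSeries ℚ) * ((j : PowerSeries ℚ) - 1) := by
  induction j with
  | zero => simp
  | succ j ih =>
    rw [Nat.choose_succ_succ' j 1, Nat.choose_one_right]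
    push_cast
    linear_combination ih

/-- `6·C(j,3) = j(j−1)(j−2)` as an identity of casts. [cite: MadrasSlade1993, §1.1 eq. (1.1.8) p. 5; lane plumbing] -/
private theorem alg3_six_mul_cast_choose_three (j : ℕ) :
    (6 : PowerSeries ℚ) * ((j.choose 3 : ℕ) : PowerSeries ℚ) =
      (j : PowerSeries ℚ) * ((j : PowerSeries ℚ) - 1) * ((j : PowerSeries ℚ) - 2) := by
  induction j with
  | zero => simp
  | succ j ih =>
    rw [Nat.choose_succ_succ' j 2]
    push_cast
    linear_combination ih + 3 * alg3_two_mul_cast_choose_two j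

/-- In `ℚ⟦X⟧`, `X^n ∣ 24·ι⁴·f` implies `X^n ∣ f` (`24` and `ι = (1+2X)⁻¹` are units).
[cite: MadrasSlade1993, §1.1 eq. (1.1.8) p. 5; lane plumbing] -/
private theorem alg3_dvd_of_dvd_unit_mul {n : ℕ} {f : PowerSeries ℚ} (a : ℕ) (q : ℚ) (hq : q ≠ 0)
    (h : (PowerSeries.X : PowerSeries ℚ) ^ n ∣ PowerSeries.C q * PowerSeries.mk (fun i : ℕ => (-2 : ℚ) ^ i) ^ a * f) :
    (PowerSeries.X : PowerSeries ℚ) ^ n ∣ f := by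
  have hF1 := alg3_iota_mul
  have key : (PowerSeries.C q⁻¹ * (1 + PowerSeries.C (2 : ℚ) * PowerSeries.X) ^ a) *
      (PowerSeries.C q * PowerSeries.mk (fun i : ℕ => (-2 : ℚ) ^ i) ^ a * f) = f := by
    have hrw : (PowerSeries.C q⁻¹ * (1 + PowerSeries.C (2 : ℚ) * PowerSeries.X) ^ a) *
        (PowerSeries.C q * PowerSeries.mk (fun i : ℕ => (-2 : ℚ) ^ i) ^ a * f) =
        (PowerSeries.C q⁻¹ * PowerSeries.C q) *
          ((1 + PowerSeries.C (2 : ℚ) * PowerSeries.X) * PowerSeries.mk (fun i : ℕ => (-2 : ℚ) ^ i)) ^ a * f := by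
      rw [mul_pow]; ring
    rw [hrw, ← map_mul, inv_mul_cancel₀ hq, map_one, hF1, one_pow, one_mul, one_mul]
  rw [← key]
  exact dvd_mul_of_dvd_right h _

/-- ★ THE THIRD-ORDER TELESCOPING CERTIFICATE (found by computer algebra, checked here by `ring`): for `i = 1 − w`,
`Σ_{j ≤ K} w^{j+1} G_j(w, i) = A(w) + w^{K+2} R_K(w)` with explicit polynomials `A` (degree 9) and `R_K` (degree 8 in `w`, cubic in `K`),
where `G_j(w, i) = −6(j+2)w³i⁴(i² − wi + w²) + 3(j+2)(j+1)w⁴i⁵ − 6j(j+2)w²i⁵ + 3(j² − 3j + 4)i⁵ + j(j−1)(j−2)i⁶` is `24ι⁴` times the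
generic term of the third-symbol recursion with `(ι, θ, κ)` substituted (the five sums `Σ (j+2)w^j`, `Σ C(j+2,2)w^j`, `Σ j(j+2)w^j`,
`Σ (j²−3j+4)w^j`, `Σ C(j,3)w^j` against `(1−w)^{2…4}` telescope). [cite: MadrasSlade1993, §1.1 eq. (1.1.8) p. 5; lane lemma] -/
private theorem alg3_model_sum (w i : PowerSeries ℚ) (hi : i = 1 - w) (K : ℕ) :
    ∑ j ∈ Finset.range (K + 1), w ^ (j + 1) *
      (-(6 : PowerSeries ℚ) * ((j : PowerSeries ℚ) + 2) * w ^ 3 * i ^ 4 * (i ^ 2 - w * i + w ^ 2) +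
        3 * ((j : PowerSeries ℚ) + 2) * ((j : PowerSeries ℚ) + 1) * w ^ 4 * i ^ 5 -
        6 * (j : PowerSeries ℚ) * ((j : PowerSeries ℚ) + 2) * w ^ 2 * i ^ 5 +
        3 * ((j : PowerSeries ℚ) ^ 2 - 3 * (j : PowerSeries ℚ) + 4) * i ^ 5 +
        (j : PowerSeries ℚ) * ((j : PowerSeries ℚ) - 1) * ((j : PowerSeries ℚ) - 2) * i ^ 6) =
    (12 * w - 54 * w ^ 2 + 96 * w ^ 3 - 102 * w ^ 4 + 126 * w ^ 5 - 186 * w ^ 6 + 180 * w ^ 7 - 90 * w ^ 8 + 18 * w ^ 9) +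
      w ^ (K + 2) * ((-(K : PowerSeries ℚ) ^ 3 - 3 * (K : PowerSeries ℚ) ^ 2 + 4 * (K : PowerSeries ℚ) - 6) +
        (5 * (K : PowerSeries ℚ) ^ 3 + 9 * (K : PowerSeries ℚ) ^ 2 - 26 * (K : PowerSeries ℚ) + 24) * w +
        (-10 * (K : PowerSeries ℚ) ^ 3 + 76 * (K : PowerSeries ℚ) - 30) * w ^ 2 +
        (10 * (K : PowerSeries ℚ) ^ 3 - 30 * (K : PowerSeries ℚ) ^ 2 - 118 * (K : PowerSeries ℚ) + 24) * w ^ 3 +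
        (-5 * (K : PowerSeries ℚ) ^ 3 + 42 * (K : PowerSeries ℚ) ^ 2 + 65 * (K : PowerSeries ℚ) - 108) * w ^ 4 +
        ((K : PowerSeries ℚ) ^ 3 - 15 * (K : PowerSeries ℚ) ^ 2 + 86 * (K : PowerSeries ℚ) + 288) * w ^ 5 +
        (-12 * (K : PowerSeries ℚ) ^ 2 - 174 * (K : PowerSeries ℚ) - 342) * w ^ 6 +
        (12 * (K : PowerSeries ℚ) ^ 2 + 114 * (K : PowerSeries ℚ) + 192) * w ^ 7 +
        (-3 * (K : PowerSeries ℚ) ^ 2 - 27 * (K : PowerSeries ℚ) - 42) * w ^ 8) := by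
  subst hi
  induction K with
  | zero => rw [Finset.sum_range_one]; push_cast; ring
  | succ K ih => rw [Finset.sum_range_succ, ih]; push_cast; ring

/-- ★ The generic TERM of the third-symbol recursion with `(σ, τ, υ) := (ι, θ, κ)`, multiplied by `24ι⁴`, is `w^{j+1} G_j(w, ι)`
(`w = 2Xι`; binomials converted by `2C(j+2,2) = (j+2)(j+1)`, `6C(j,3) = j(j−1)(j−2)`) — except on the two cells `j = 0, 1` (costs
`c = 1, 2`), where the census third symbol `t₃` is `0` instead of the uniform `2^{j−2}(j² − 3j + 4) = 1`, giving the corrections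
`−24Xι⁶`, `−24X²ι⁷`. Pure ring identity (any `X`, `ι`). [cite: MadrasSlade1993, §1.1 eq. (1.1.8) p. 5; lane lemma] -/
private theorem alg3_term (j : ℕ) (X ι : PowerSeries ℚ) :
    24 * ι ^ 4 * (X ^ (j + 1) *
      ((2 : PowerSeries ℚ) ^ (j + 1) * ((((j + 2 : ℕ) : PowerSeries ℚ)) * ι ^ (j + 1) *
          (-(2 * X ^ 3 * (1 - 2 * X + 4 * X ^ 2) * ι ^ 5)) +
          (((j + 2).choose 2 : ℕ) : PowerSeries ℚ) * ι ^ j * (2 * X ^ 2 * ι ^ 3) ^ 2) -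
        ((j : PowerSeries ℚ) * 2 ^ j) * ((((j + 2 : ℕ) : PowerSeries ℚ)) * ι ^ (j + 1) * (2 * X ^ 2 * ι ^ 3)) +
        (if 2 ≤ j then (2 : PowerSeries ℚ) ^ (j - 2) * ((j : PowerSeries ℚ) ^ 2 - 3 * (j : PowerSeries ℚ) + 4) else 0) * ι ^ (j + 2) +
        (((j.choose 3 : ℕ) : PowerSeries ℚ) * 2 ^ (j - 1)) * ι ^ (j + 3))) =
    (2 * X * ι) ^ (j + 1) *
      (-(6 : PowerSeries ℚ) * ((j : PowerSeries ℚ) + 2) * (2 * X * ι) ^ 3 * ι ^ 4 * (ι ^ 2 - (2 * X * ι) * ι + (2 * X * ι) ^ 2) +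
        3 * ((j : PowerSeries ℚ) + 2) * ((j : PowerSeries ℚ) + 1) * (2 * X * ι) ^ 4 * ι ^ 5 -
        6 * (j : PowerSeries ℚ) * ((j : PowerSeries ℚ) + 2) * (2 * X * ι) ^ 2 * ι ^ 5 +
        3 * ((j : PowerSeries ℚ) ^ 2 - 3 * (j : PowerSeries ℚ) + 4) * ι ^ 5 +
        (j : PowerSeries ℚ) * ((j : PowerSeries ℚ) - 1) * ((j : PowerSeries ℚ) - 2) * ι ^ 6) -
    (if j < 2 then 24 * X ^ (j + 1) * ι ^ (j + 6) else 0) := by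
  rcases j with _ | _ | m
  · simp only [show ¬ (2 ≤ 0) by omega, show (0 : ℕ) < 2 by omega, if_false, if_true, Nat.choose_zero_succ,
      Nat.choose_self]
    push_cast
    ring
  · simp only [show ¬ (2 ≤ 1) by omega, show (1 : ℕ) < 2 by omega, if_false, if_true,
      show Nat.choose 1 3 = 0 by decide, show Nat.choose 3 2 = 3 by decide]
    push_cast
    ring
  · rw [if_pos (by omega : 2 ≤ m + 2), if_neg (by omega : ¬ m + 2 < 2), show m + 2 - 2 = m by omega,
      show m + 2 - 1 = m + 1 by omega]
    have e2 := alg3_two_mul_cast_choose_two (m + 2 + 2)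
    have e3 := alg3_six_mul_cast_choose_three (m + 2)
    push_cast at e2 e3 ⊢
    linear_combination (3 * (2 * X * ι) ^ (m + 2 + 5) * ι ^ 5) * e2 + ((2 * X * ι) ^ (m + 2 + 1) * ι ^ 6) * e3

/-- ★ The CLOSING IDENTITY of the third-order fixed point: with `w = 2Xι` and `κ = −2X³(1 − 2X + 4X²)ι⁵`,
`−A(w) + 24Xι⁶ + 24X²ι⁷ = 24ι⁴κ` in `ℚ⟦X⟧` (uses `(1+2X)ι = 1`; the certificate multiplying that relation was found by computer
algebra). Equivalently `κ/ι² = −θ²w/ι⁴ + (θ/2)(w(1+w)/ι³ − w/ι) − (ι/8)Σ_{c≥3}(c²−5c+8)w^c/ι^c… − w⁴/(4ι²)`: the third symbol of the fixed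
point is `κ = −(w³/4)(1 − 3w + 3w²)`. [cite: MadrasSlade1993, §1.1 eq. (1.1.8) p. 5; lane lemma] -/
private theorem alg3_close (X ι : PowerSeries ℚ) (hF1 : (1 + 2 * X) * ι = 1) :
    -(12 * (2 * X * ι) - 54 * (2 * X * ι) ^ 2 + 96 * (2 * X * ι) ^ 3 - 102 * (2 * X * ι) ^ 4 + 126 * (2 * X * ι) ^ 5 -
        186 * (2 * X * ι) ^ 6 + 180 * (2 * X * ι) ^ 7 - 90 * (2 * X * ι) ^ 8 + 18 * (2 * X * ι) ^ 9) +
      24 * X * ι ^ 6 + 24 * X ^ 2 * ι ^ 7 - 24 * ι ^ 4 * (-(2 * X ^ 3 * (1 - 2 * X + 4 * X ^ 2) * ι ^ 5)) = 0 := by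
  linear_combination (-4608 * X ^ 8 * ι ^ 8 + 2304 * X ^ 7 * ι ^ 8 - 1152 * X ^ 6 * ι ^ 8 + 9216 * X ^ 7 * ι ^ 7 +
    576 * X ^ 5 * ι ^ 8 - 3456 * X ^ 6 * ι ^ 7 - 192 * X ^ 4 * ι ^ 8 + 1152 * X ^ 5 * ι ^ 7 - 6912 * X ^ 6 * ι ^ 6 +
    48 * X ^ 3 * ι ^ 8 - 288 * X ^ 4 * ι ^ 7 + 1728 * X ^ 5 * ι ^ 6 + 48 * X ^ 3 * ι ^ 7 - 288 * X ^ 4 * ι ^ 6 +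
    2496 * X ^ 5 * ι ^ 5 - 384 * X ^ 4 * ι ^ 5 + 24 * X ^ 2 * ι ^ 6 + 48 * X ^ 3 * ι ^ 5 - 768 * X ^ 4 * ι ^ 4 -
    24 * X ^ 2 * ι ^ 5 + 192 * X ^ 3 * ι ^ 4 + 24 * X * ι ^ 5 - 72 * X ^ 2 * ι ^ 4 + 432 * X ^ 3 * ι ^ 3 + 24 * X * ι ^ 4 -
    120 * X ^ 2 * ι ^ 3 + 24 * X * ι ^ 3 - 168 * X ^ 2 * ι ^ 2 + 24 * X * ι ^ 2 + 24 * X * ι) * hF1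

end Algebra3


section Step3

/-- ★★ THE THIRD-SYMBOL RECURSION PRESERVES `κ`: if `σ ≡ ι`, `τ ≡ θ = 2X²ι³` and `υ ≡ κ = −2X³(1 − 2X + 4X²)ι⁵ (mod X^{K+1})`, then the
third symbol polynomial of `A_{K+1}` produced by the recursion (`gsym3_A_succ`) is `≡ κ (mod X^{K+2})` — at third order in `1/d` the fixed
point of the cost series is `U = ι + θ/d + κ/d² + O(d⁻³)` in the scaled variable. Proof: `24ι⁴ ×` (recursion at `(ι, θ, κ)`) is the
telescoping sum of `alg3_model_sum` up to the two exceptional cells `c = 1, 2` (`alg3_term`), and the boundary polynomial `A(w)` plus the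
two corrections equals `24ι⁴κ` (`alg3_close`). [cite: MadrasSlade1993, §1.1 eq. (1.1.8) p. 5; lane lemma] -/
private theorem alg3_A_step_third {K : ℕ} {σ τ υ : Polynomial ℚ}
    (hσ : (PowerSeries.X : PowerSeries ℚ) ^ (K + 1) ∣ ((σ : PowerSeries ℚ) - PowerSeries.mk (fun i : ℕ => (-2 : ℚ) ^ i)))
    (hτ : (PowerSeries.X : PowerSeries ℚ) ^ (K + 1) ∣ ((τ : PowerSeries ℚ) -
      PowerSeries.C (2 : ℚ) * PowerSeries.X ^ 2 * PowerSeries.mk (fun i : ℕ => (-2 : ℚ) ^ i) ^ 3))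
    (hυ : (PowerSeries.X : PowerSeries ℚ) ^ (K + 1) ∣ ((υ : PowerSeries ℚ) -
      -(PowerSeries.C (2 : ℚ) * PowerSeries.X ^ 3 * (1 - PowerSeries.C (2 : ℚ) * PowerSeries.X + PowerSeries.C (4 : ℚ) * PowerSeries.X ^ 2) *
        PowerSeries.mk (fun i : ℕ => (-2 : ℚ) ^ i) ^ 5))) :
    (PowerSeries.X : PowerSeries ℚ) ^ (K + 2) ∣
      ((((0 - ∑ j ∈ Finset.range (K + 1), Polynomial.X ^ (j + 1) *
        (Polynomial.C ((2 : ℚ) ^ (j + 1)) * (((j + 2 : ℕ) : Polynomial ℚ) * σ ^ (j + 1) * υ +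
            (((j + 2).choose 2 : ℕ) : Polynomial ℚ) * σ ^ j * τ ^ 2) -
          Polynomial.C ((j : ℚ) * 2 ^ j) * (((j + 2 : ℕ) : Polynomial ℚ) * σ ^ (j + 1) * τ) +
          Polynomial.C (if 2 ≤ j then (2 : ℚ) ^ (j - 2) * ((j : ℚ) ^ 2 - 3 * j + 4) else 0) * σ ^ (j + 2) +
          Polynomial.C (((j.choose 3 : ℕ) : ℚ) * 2 ^ (j - 1)) * σ ^ (j + 3)) : Polynomial ℚ)) : PowerSeries ℚ) -
        -(PowerSeries.C (2 : ℚ) * PowerSeries.X ^ 3 * (1 - PowerSeries.C (2 : ℚ) * PowerSeries.X + PowerSeries.C (4 : ℚ) * PowerSeries.X ^ 2) *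
          PowerSeries.mk (fun i : ℕ => (-2 : ℚ) ^ i) ^ 5)) := by
  set ι : PowerSeries ℚ := PowerSeries.mk (fun i : ℕ => (-2 : ℚ) ^ i) with hι
  have hF1' : (1 + PowerSeries.C (2 : ℚ) * PowerSeries.X) * ι = 1 := alg3_iota_mul
  have hC2 : PowerSeries.C (2 : ℚ) = 2 := map_ofNat _ 2
  have hC3 : PowerSeries.C (3 : ℚ) = 3 := map_ofNat _ 3
  have hC4 : PowerSeries.C (4 : ℚ) = 4 := map_ofNat _ 4
  have hF1 : (1 + 2 * PowerSeries.X) * ι = 1 := by rw [← hC2]; exact hF1'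
  rw [hC2] at hτ
  rw [hC2, hC4] at hυ
  rw [hC2, hC4]
  -- (1) cast of the polynomial
  have hQ : (((0 - ∑ j ∈ Finset.range (K + 1), Polynomial.X ^ (j + 1) *
        (Polynomial.C ((2 : ℚ) ^ (j + 1)) * (((j + 2 : ℕ) : Polynomial ℚ) * σ ^ (j + 1) * υ +
            (((j + 2).choose 2 : ℕ) : Polynomial ℚ) * σ ^ j * τ ^ 2) -
          Polynomial.C ((j : ℚ) * 2 ^ j) * (((j + 2 : ℕ) : Polynomial ℚ) * σ ^ (j + 1) * τ) +
          Polynomial.C (if 2 ≤ j then (2 : ℚ) ^ (j - 2) * ((j : ℚ) ^ 2 - 3 * j + 4) else 0) * σ ^ (j + 2) +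
          Polynomial.C (((j.choose 3 : ℕ) : ℚ) * 2 ^ (j - 1)) * σ ^ (j + 3)) : Polynomial ℚ)) : PowerSeries ℚ) =
      0 - ∑ j ∈ Finset.range (K + 1), PowerSeries.X ^ (j + 1) *
        ((2 : PowerSeries ℚ) ^ (j + 1) * ((((j + 2 : ℕ) : PowerSeries ℚ)) * (σ : PowerSeries ℚ) ^ (j + 1) * (υ : PowerSeries ℚ) +
            (((j + 2).choose 2 : ℕ) : PowerSeries ℚ) * (σ : PowerSeries ℚ) ^ j * (τ : PowerSeries ℚ) ^ 2) -
          ((j : PowerSeries ℚ) * 2 ^ j) * ((((j + 2 : ℕ) : PowerSeries ℚ)) * (σ : PowerSeries ℚ) ^ (j + 1) * (τ : PowerSeries ℚ)) +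
          (if 2 ≤ j then (2 : PowerSeries ℚ) ^ (j - 2) * ((j : PowerSeries ℚ) ^ 2 - 3 * (j : PowerSeries ℚ) + 4) else 0) *
            (σ : PowerSeries ℚ) ^ (j + 2) +
          (((j.choose 3 : ℕ) : PowerSeries ℚ) * 2 ^ (j - 1)) * (σ : PowerSeries ℚ) ^ (j + 3)) := by
    rw [← Polynomial.coeToPowerSeries.ringHom_apply, map_sub, map_zero, map_sum]
    refine congrArg _ (Finset.sum_congr rfl fun j _ => ?_)
    simp only [map_mul, map_pow, map_add, map_sub, map_natCast, map_zero, Polynomial.coeToPowerSeries.ringHom_apply,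
      Polynomial.coe_C, Polynomial.coe_X, apply_ite PowerSeries.C, hC2, hC3, hC4]
  rw [hQ]
  set X : PowerSeries ℚ := PowerSeries.X with hX
  set θ : PowerSeries ℚ := 2 * X ^ 2 * ι ^ 3 with hθ
  set κ : PowerSeries ℚ := -(2 * X ^ 3 * (1 - 2 * X + 4 * X ^ 2) * ι ^ 5) with hκ
  -- divisibility of `w = 2Xι`, `θ`, `κ` by powers of `X`
  have hwX : X ∣ 2 * X * ι := Dvd.intro_left 2 (by ring) |>.mul_right ι
  have hθX : X ^ 2 ∣ θ := by rw [hθ]; exact Dvd.intro_left 2 (by ring) |>.mul_right _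
  have hκX : X ^ 3 ∣ κ := by rw [hκ]; exact Dvd.intro (-(2 * (1 - 2 * X + 4 * X ^ 2) * ι ^ 5)) (by ring)
  -- (2) the model (inputs replaced by their limits) and its distance to the actual sum
  have hσpow : ∀ m : ℕ, X ^ (K + 1) ∣ (σ : PowerSeries ℚ) ^ m - ι ^ m := fun m => hσ.trans (sub_dvd_pow_sub_pow _ _ m)
  have hστ : ∀ m : ℕ, X ^ (K + 1) ∣ (σ : PowerSeries ℚ) ^ m * (τ : PowerSeries ℚ) - ι ^ m * θ := by
    intro m
    have : (σ : PowerSeries ℚ) ^ m * (τ : PowerSeries ℚ) - ι ^ m * θ =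
        (σ : PowerSeries ℚ) ^ m * ((τ : PowerSeries ℚ) - θ) + ((σ : PowerSeries ℚ) ^ m - ι ^ m) * θ := by ring
    rw [this]
    exact dvd_add (dvd_mul_of_dvd_right hτ _) (dvd_mul_of_dvd_left (hσpow m) _)
  have hσττ : ∀ m : ℕ, X ^ (K + 1) ∣ (σ : PowerSeries ℚ) ^ m * (τ : PowerSeries ℚ) ^ 2 - ι ^ m * θ ^ 2 := by
    intro m
    have : (σ : PowerSeries ℚ) ^ m * (τ : PowerSeries ℚ) ^ 2 - ι ^ m * θ ^ 2 =
        (σ : PowerSeries ℚ) ^ m * ((τ : PowerSeries ℚ) + θ) * ((τ : PowerSeries ℚ) - θ) + ((σ : PowerSeries ℚ) ^ m - ι ^ m) * θ ^ 2 := by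
      ring
    rw [this]
    exact dvd_add (dvd_mul_of_dvd_right hτ _) (dvd_mul_of_dvd_left (hσpow m) _)
  have hσυ : ∀ m : ℕ, X ^ (K + 1) ∣ (σ : PowerSeries ℚ) ^ m * (υ : PowerSeries ℚ) - ι ^ m * κ := by
    intro m
    have : (σ : PowerSeries ℚ) ^ m * (υ : PowerSeries ℚ) - ι ^ m * κ =
        (σ : PowerSeries ℚ) ^ m * ((υ : PowerSeries ℚ) - κ) + ((σ : PowerSeries ℚ) ^ m - ι ^ m) * κ := by ring
    rw [this]
    exact dvd_add (dvd_mul_of_dvd_right hυ _) (dvd_mul_of_dvd_left (hσpow m) _)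
  have hshift : ∀ j : ℕ, ∀ g : PowerSeries ℚ, X ^ (K + 1) ∣ g → X ^ (K + 2) ∣ X ^ (j + 1) * g := by
    intro j g hg
    rw [show K + 2 = 1 + (K + 1) by ring, pow_add, pow_one]
    exact mul_dvd_mul (dvd_pow_self _ (Nat.succ_ne_zero j)) hg
  -- the model sum
  set M : PowerSeries ℚ := 0 - ∑ j ∈ Finset.range (K + 1), X ^ (j + 1) *
        ((2 : PowerSeries ℚ) ^ (j + 1) * ((((j + 2 : ℕ) : PowerSeries ℚ)) * ι ^ (j + 1) * κ +
            (((j + 2).choose 2 : ℕ) : PowerSeries ℚ) * ι ^ j * θ ^ 2) -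
          ((j : PowerSeries ℚ) * 2 ^ j) * ((((j + 2 : ℕ) : PowerSeries ℚ)) * ι ^ (j + 1) * θ) +
          (if 2 ≤ j then (2 : PowerSeries ℚ) ^ (j - 2) * ((j : PowerSeries ℚ) ^ 2 - 3 * (j : PowerSeries ℚ) + 4) else 0) * ι ^ (j + 2) +
          (((j.choose 3 : ℕ) : PowerSeries ℚ) * 2 ^ (j - 1)) * ι ^ (j + 3)) with hM
  have hdiff : X ^ (K + 2) ∣ (0 - ∑ j ∈ Finset.range (K + 1), X ^ (j + 1) *
        ((2 : PowerSeries ℚ) ^ (j + 1) * ((((j + 2 : ℕ) : PowerSeries ℚ)) * (σ : PowerSeries ℚ) ^ (j + 1) * (υ : PowerSeries ℚ) +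
            (((j + 2).choose 2 : ℕ) : PowerSeries ℚ) * (σ : PowerSeries ℚ) ^ j * (τ : PowerSeries ℚ) ^ 2) -
          ((j : PowerSeries ℚ) * 2 ^ j) * ((((j + 2 : ℕ) : PowerSeries ℚ)) * (σ : PowerSeries ℚ) ^ (j + 1) * (τ : PowerSeries ℚ)) +
          (if 2 ≤ j then (2 : PowerSeries ℚ) ^ (j - 2) * ((j : PowerSeries ℚ) ^ 2 - 3 * (j : PowerSeries ℚ) + 4) else 0) *
            (σ : PowerSeries ℚ) ^ (j + 2) +
          (((j.choose 3 : ℕ) : PowerSeries ℚ) * 2 ^ (j - 1)) * (σ : PowerSeries ℚ) ^ (j + 3))) - M := by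
    rw [hM, show ∀ a b : PowerSeries ℚ, (0 - a) - (0 - b) = -(a - b) from fun a b => by ring, ← Finset.sum_sub_distrib, dvd_neg]
    refine Finset.dvd_sum fun j _ => ?_
    have hsplit : X ^ (j + 1) *
        ((2 : PowerSeries ℚ) ^ (j + 1) * ((((j + 2 : ℕ) : PowerSeries ℚ)) * (σ : PowerSeries ℚ) ^ (j + 1) * (υ : PowerSeries ℚ) +
            (((j + 2).choose 2 : ℕ) : PowerSeries ℚ) * (σ : PowerSeries ℚ) ^ j * (τ : PowerSeries ℚ) ^ 2) -
          ((j : PowerSeries ℚ) * 2 ^ j) * ((((j + 2 : ℕ) : PowerSeries ℚ)) * (σ : PowerSeries ℚ) ^ (j + 1) * (τ : PowerSeries ℚ)) +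
          (if 2 ≤ j then (2 : PowerSeries ℚ) ^ (j - 2) * ((j : PowerSeries ℚ) ^ 2 - 3 * (j : PowerSeries ℚ) + 4) else 0) *
            (σ : PowerSeries ℚ) ^ (j + 2) +
          (((j.choose 3 : ℕ) : PowerSeries ℚ) * 2 ^ (j - 1)) * (σ : PowerSeries ℚ) ^ (j + 3)) -
        X ^ (j + 1) *
        ((2 : PowerSeries ℚ) ^ (j + 1) * ((((j + 2 : ℕ) : PowerSeries ℚ)) * ι ^ (j + 1) * κ +
            (((j + 2).choose 2 : ℕ) : PowerSeries ℚ) * ι ^ j * θ ^ 2) -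
          ((j : PowerSeries ℚ) * 2 ^ j) * ((((j + 2 : ℕ) : PowerSeries ℚ)) * ι ^ (j + 1) * θ) +
          (if 2 ≤ j then (2 : PowerSeries ℚ) ^ (j - 2) * ((j : PowerSeries ℚ) ^ 2 - 3 * (j : PowerSeries ℚ) + 4) else 0) * ι ^ (j + 2) +
          (((j.choose 3 : ℕ) : PowerSeries ℚ) * 2 ^ (j - 1)) * ι ^ (j + 3)) =
        X ^ (j + 1) *
        ((2 : PowerSeries ℚ) ^ (j + 1) * ((((j + 2 : ℕ) : PowerSeries ℚ)) * ((σ : PowerSeries ℚ) ^ (j + 1) * (υ : PowerSeries ℚ) - ι ^ (j + 1) * κ) +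
            (((j + 2).choose 2 : ℕ) : PowerSeries ℚ) * ((σ : PowerSeries ℚ) ^ j * (τ : PowerSeries ℚ) ^ 2 - ι ^ j * θ ^ 2)) -
          ((j : PowerSeries ℚ) * 2 ^ j) * ((((j + 2 : ℕ) : PowerSeries ℚ)) * ((σ : PowerSeries ℚ) ^ (j + 1) * (τ : PowerSeries ℚ) - ι ^ (j + 1) * θ)) +
          (if 2 ≤ j then (2 : PowerSeries ℚ) ^ (j - 2) * ((j : PowerSeries ℚ) ^ 2 - 3 * (j : PowerSeries ℚ) + 4) else 0) *
            ((σ : PowerSeries ℚ) ^ (j + 2) - ι ^ (j + 2)) +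
          (((j.choose 3 : ℕ) : PowerSeries ℚ) * 2 ^ (j - 1)) * ((σ : PowerSeries ℚ) ^ (j + 3) - ι ^ (j + 3))) := by ring
    rw [hsplit]
    refine hshift j _ ?_
    refine dvd_add (dvd_add (dvd_sub (dvd_mul_of_dvd_right (dvd_add (dvd_mul_of_dvd_right (hσυ _) _)
      (dvd_mul_of_dvd_right (hσττ _) _)) _) (dvd_mul_of_dvd_right (dvd_mul_of_dvd_right (hστ _) _) _))
      (dvd_mul_of_dvd_right (hσpow _) _)) (dvd_mul_of_dvd_right (hσpow _) _)
  -- (3) `24ι⁴ · M` in closed form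
  have hι1 : ι = 1 - 2 * X * ι := by linear_combination hF1
  have hsum := alg3_model_sum (2 * X * ι) ι hι1 K
  have h24M : 24 * ι ^ 4 * M = -(∑ j ∈ Finset.range (K + 1), (2 * X * ι) ^ (j + 1) *
      (-(6 : PowerSeries ℚ) * ((j : PowerSeries ℚ) + 2) * (2 * X * ι) ^ 3 * ι ^ 4 * (ι ^ 2 - (2 * X * ι) * ι + (2 * X * ι) ^ 2) +
        3 * ((j : PowerSeries ℚ) + 2) * ((j : PowerSeries ℚ) + 1) * (2 * X * ι) ^ 4 * ι ^ 5 -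
        6 * (j : PowerSeries ℚ) * ((j : PowerSeries ℚ) + 2) * (2 * X * ι) ^ 2 * ι ^ 5 +
        3 * ((j : PowerSeries ℚ) ^ 2 - 3 * (j : PowerSeries ℚ) + 4) * ι ^ 5 +
        (j : PowerSeries ℚ) * ((j : PowerSeries ℚ) - 1) * ((j : PowerSeries ℚ) - 2) * ι ^ 6)) +
      ∑ j ∈ Finset.range (K + 1), (if j < 2 then 24 * X ^ (j + 1) * ι ^ (j + 6) else 0) := by
    rw [hM, mul_sub, mul_zero, zero_sub, Finset.mul_sum, hθ, hκ, Finset.sum_congr rfl (fun j _ => alg3_term j X ι),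
      Finset.sum_sub_distrib]
    ring
  rw [hsum] at h24M
  -- (4) the corrections: `Σ_{j ≤ K} corr_j − 24Xι⁶ − 24X²ι⁷` is `−24X²ι⁷` for `K = 0` and `0` for `K ≥ 1`
  have hcorr : X ^ (K + 2) ∣ (∑ j ∈ Finset.range (K + 1), (if j < 2 then 24 * X ^ (j + 1) * ι ^ (j + 6) else 0)) -
      24 * X * ι ^ 6 - 24 * X ^ 2 * ι ^ 7 := by
    rcases K with _ | K
    · rw [Finset.sum_range_one, if_pos (by omega : 0 < 2)]
      exact Dvd.intro (-(24 * ι ^ 7)) (by ring)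
    · rw [Finset.sum_eq_add_of_mem 0 1 (Finset.mem_range.2 (by omega)) (Finset.mem_range.2 (by omega)) (by omega)
        (fun c _ hc => by rw [if_neg (by omega)]), if_pos (by omega : 0 < 2), if_pos (by omega : 1 < 2)]
      simp
  -- (5) assemble: `24ι⁴ (actual − κ) = 24ι⁴ (actual − M) + (24ι⁴ M − 24ι⁴ κ)`
  have hclose := alg3_close X ι hF1
  apply alg3_dvd_of_dvd_unit_mul 4 24 (by norm_num)
  rw [show PowerSeries.C (24 : ℚ) = 24 from map_ofNat _ 24, ← hι]
  have key : ∀ a : PowerSeries ℚ, 24 * ι ^ 4 * (a - κ) = 24 * ι ^ 4 * (a - M) + (24 * ι ^ 4 * M - 24 * ι ^ 4 * κ) := fun a => by ring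
  rw [key, h24M]
  refine dvd_add (dvd_mul_of_dvd_right hdiff _) ?_
  have key2 : -((12 * (2 * X * ι) - 54 * (2 * X * ι) ^ 2 + 96 * (2 * X * ι) ^ 3 - 102 * (2 * X * ι) ^ 4 + 126 * (2 * X * ι) ^ 5 -
        186 * (2 * X * ι) ^ 6 + 180 * (2 * X * ι) ^ 7 - 90 * (2 * X * ι) ^ 8 + 18 * (2 * X * ι) ^ 9) +
      (2 * X * ι) ^ (K + 2) * ((-(K : PowerSeries ℚ) ^ 3 - 3 * (K : PowerSeries ℚ) ^ 2 + 4 * (K : PowerSeries ℚ) - 6) +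
        (5 * (K : PowerSeries ℚ) ^ 3 + 9 * (K : PowerSeries ℚ) ^ 2 - 26 * (K : PowerSeries ℚ) + 24) * (2 * X * ι) +
        (-10 * (K : PowerSeries ℚ) ^ 3 + 76 * (K : PowerSeries ℚ) - 30) * (2 * X * ι) ^ 2 +
        (10 * (K : PowerSeries ℚ) ^ 3 - 30 * (K : PowerSeries ℚ) ^ 2 - 118 * (K : PowerSeries ℚ) + 24) * (2 * X * ι) ^ 3 +
        (-5 * (K : PowerSeries ℚ) ^ 3 + 42 * (K : PowerSeries ℚ) ^ 2 + 65 * (K : PowerSeries ℚ) - 108) * (2 * X * ι) ^ 4 +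
        ((K : PowerSeries ℚ) ^ 3 - 15 * (K : PowerSeries ℚ) ^ 2 + 86 * (K : PowerSeries ℚ) + 288) * (2 * X * ι) ^ 5 +
        (-12 * (K : PowerSeries ℚ) ^ 2 - 174 * (K : PowerSeries ℚ) - 342) * (2 * X * ι) ^ 6 +
        (12 * (K : PowerSeries ℚ) ^ 2 + 114 * (K : PowerSeries ℚ) + 192) * (2 * X * ι) ^ 7 +
        (-3 * (K : PowerSeries ℚ) ^ 2 - 27 * (K : PowerSeries ℚ) - 42) * (2 * X * ι) ^ 8)) +
      (∑ j ∈ Finset.range (K + 1), (if j < 2 then 24 * X ^ (j + 1) * ι ^ (j + 6) else 0)) - 24 * ι ^ 4 * κ =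
      -((2 * X * ι) ^ (K + 2) * ((-(K : PowerSeries ℚ) ^ 3 - 3 * (K : PowerSeries ℚ) ^ 2 + 4 * (K : PowerSeries ℚ) - 6) +
        (5 * (K : PowerSeries ℚ) ^ 3 + 9 * (K : PowerSeries ℚ) ^ 2 - 26 * (K : PowerSeries ℚ) + 24) * (2 * X * ι) +
        (-10 * (K : PowerSeries ℚ) ^ 3 + 76 * (K : PowerSeries ℚ) - 30) * (2 * X * ι) ^ 2 +
        (10 * (K : PowerSeries ℚ) ^ 3 - 30 * (K : PowerSeries ℚ) ^ 2 - 118 * (K : PowerSeries ℚ) + 24) * (2 * X * ι) ^ 3 +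
        (-5 * (K : PowerSeries ℚ) ^ 3 + 42 * (K : PowerSeries ℚ) ^ 2 + 65 * (K : PowerSeries ℚ) - 108) * (2 * X * ι) ^ 4 +
        ((K : PowerSeries ℚ) ^ 3 - 15 * (K : PowerSeries ℚ) ^ 2 + 86 * (K : PowerSeries ℚ) + 288) * (2 * X * ι) ^ 5 +
        (-12 * (K : PowerSeries ℚ) ^ 2 - 174 * (K : PowerSeries ℚ) - 342) * (2 * X * ι) ^ 6 +
        (12 * (K : PowerSeries ℚ) ^ 2 + 114 * (K : PowerSeries ℚ) + 192) * (2 * X * ι) ^ 7 +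
        (-3 * (K : PowerSeries ℚ) ^ 2 - 27 * (K : PowerSeries ℚ) - 42) * (2 * X * ι) ^ 8)) +
      ((∑ j ∈ Finset.range (K + 1), (if j < 2 then 24 * X ^ (j + 1) * ι ^ (j + 6) else 0)) -
        24 * X * ι ^ 6 - 24 * X ^ 2 * ι ^ 7) := by
    rw [hκ]
    linear_combination hclose
  rw [key2]
  refine dvd_add ?_ hcorr
  rw [dvd_neg]
  exact dvd_mul_of_dvd_left (pow_dvd_pow_of_dvd hwX _) _

end Step3


/-! ### The third symbol of the inverse series `E_k` -/

section Inverse3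

/-- The second geometric identity: `(1 − w)² Σ_{m<k} (m+1) w^m = 1 − (k+1) w^k + k w^{k+1}`.
[cite: MadrasSlade1993, §1.1 eq. (1.1.8) p. 5; lane plumbing] -/
private theorem alg3_geom2 (w : PowerSeries ℚ) (k : ℕ) :
    (1 - w) ^ 2 * ∑ m ∈ Finset.range k, ((m + 1 : ℕ) : PowerSeries ℚ) * w ^ m =
      1 - ((k + 1 : ℕ) : PowerSeries ℚ) * w ^ k + ((k : ℕ) : PowerSeries ℚ) * w ^ (k + 1) := by
  induction k with
  | zero => rw [Finset.sum_range_zero]; push_cast; ring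
  | succ k ih => rw [Finset.sum_range_succ, mul_add, ih]; push_cast; ring

/-- The third geometric identity (doubled): `2(1 − w)³ Σ_{m<n} C(m+2,2) w^m = 2 + w^n Q_n(w)` with
`Q_n(w) = −(n²+3n+2) + (2n²+4n) w − (n²+n) w²`. [cite: MadrasSlade1993, §1.1 eq. (1.1.8) p. 5; lane plumbing] -/
private theorem alg3_geom3 (w : PowerSeries ℚ) (n : ℕ) :
    2 * (1 - w) ^ 3 * ∑ m ∈ Finset.range n, (((m + 2).choose 2 : ℕ) : PowerSeries ℚ) * w ^ m =
      2 + w ^ n * (-((n : PowerSeries ℚ) ^ 2 + 3 * (n : PowerSeries ℚ) + 2) +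
        (2 * (n : PowerSeries ℚ) ^ 2 + 4 * (n : PowerSeries ℚ)) * w - ((n : PowerSeries ℚ) ^ 2 + (n : PowerSeries ℚ)) * w ^ 2) := by
  induction n with
  | zero => rw [Finset.sum_range_zero]; push_cast; ring
  | succ n ih =>
    rw [Finset.sum_range_succ, mul_add, ih]
    have e2 := alg3_two_mul_cast_choose_two (n + 2)
    push_cast at e2 ⊢
    linear_combination ((1 - w) ^ 3 * w ^ n) * e2

/-- `Σ_n (n+1)(−2)^n X^n = ι²`. [cite: MadrasSlade1993, §1.1 eq. (1.1.8) p. 5; lane plumbing] -/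
private theorem alg3_iota_sq :
    PowerSeries.mk (fun n : ℕ => ((n : ℚ) + 1) * (-2 : ℚ) ^ n) = PowerSeries.mk (fun i : ℕ => (-2 : ℚ) ^ i) ^ 2 := by
  have hF1 := alg3_iota_mul
  have h2 : (1 + PowerSeries.C (2 : ℚ) * PowerSeries.X) * PowerSeries.mk (fun n : ℕ => ((n : ℚ) + 1) * (-2 : ℚ) ^ n) =
      PowerSeries.mk (fun i : ℕ => (-2 : ℚ) ^ i) := by
    ext n
    rw [add_mul, one_mul, map_add, PowerSeries.coeff_mk, mul_assoc, PowerSeries.coeff_C_mul, PowerSeries.coeff_mk]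
    rcases n with _ | n
    · rw [PowerSeries.coeff_zero_X_mul, mul_zero, add_zero]; norm_num
    · rw [PowerSeries.coeff_succ_X_mul, PowerSeries.coeff_mk, pow_succ]; push_cast; ring
  calc PowerSeries.mk (fun n : ℕ => ((n : ℚ) + 1) * (-2 : ℚ) ^ n)
      = ((1 + PowerSeries.C (2 : ℚ) * PowerSeries.X) * PowerSeries.mk (fun i : ℕ => (-2 : ℚ) ^ i)) *
          PowerSeries.mk (fun n : ℕ => ((n : ℚ) + 1) * (-2 : ℚ) ^ n) := by rw [hF1, one_mul]
    _ = PowerSeries.mk (fun i : ℕ => (-2 : ℚ) ^ i) *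
          ((1 + PowerSeries.C (2 : ℚ) * PowerSeries.X) * PowerSeries.mk (fun n : ℕ => ((n : ℚ) + 1) * (-2 : ℚ) ^ n)) := by ring
    _ = _ := by rw [h2, pow_two]

/-- `Σ_n ((n+1)(n+2)/2)(−2)^n X^n = ι³`. [cite: MadrasSlade1993, §1.1 eq. (1.1.8) p. 5; lane plumbing] -/
private theorem alg3_iota_cube :
    PowerSeries.mk (fun n : ℕ => ((n : ℚ) + 1) * ((n : ℚ) + 2) / 2 * (-2 : ℚ) ^ n) = PowerSeries.mk (fun i : ℕ => (-2 : ℚ) ^ i) ^ 3 := by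
  have hF1 := alg3_iota_mul
  have h3 : (1 + PowerSeries.C (2 : ℚ) * PowerSeries.X) * PowerSeries.mk (fun n : ℕ => ((n : ℚ) + 1) * ((n : ℚ) + 2) / 2 * (-2 : ℚ) ^ n) =
      PowerSeries.mk (fun n : ℕ => ((n : ℚ) + 1) * (-2 : ℚ) ^ n) := by
    ext n
    rw [add_mul, one_mul, map_add, PowerSeries.coeff_mk, mul_assoc, PowerSeries.coeff_C_mul, PowerSeries.coeff_mk]
    rcases n with _ | n
    · rw [PowerSeries.coeff_zero_X_mul, mul_zero, add_zero]; norm_num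
    · rw [PowerSeries.coeff_succ_X_mul, PowerSeries.coeff_mk, pow_succ]; push_cast; ring
  calc PowerSeries.mk (fun n : ℕ => ((n : ℚ) + 1) * ((n : ℚ) + 2) / 2 * (-2 : ℚ) ^ n)
      = ((1 + PowerSeries.C (2 : ℚ) * PowerSeries.X) * PowerSeries.mk (fun i : ℕ => (-2 : ℚ) ^ i)) *
          PowerSeries.mk (fun n : ℕ => ((n : ℚ) + 1) * ((n : ℚ) + 2) / 2 * (-2 : ℚ) ^ n) := by rw [hF1, one_mul]
    _ = PowerSeries.mk (fun i : ℕ => (-2 : ℚ) ^ i) *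
          ((1 + PowerSeries.C (2 : ℚ) * PowerSeries.X) *
            PowerSeries.mk (fun n : ℕ => ((n : ℚ) + 1) * ((n : ℚ) + 2) / 2 * (-2 : ℚ) ^ n)) := by ring
    _ = _ := by rw [h3, alg3_iota_sq]; ring

/-- `[X^k] (2X³(1 + 4X²) ι³) = (−1)^{k−1} 2^{k−2} (k² − 5k + 7)` for `k ≥ 3`. [cite: MadrasSlade1993, §1.1 eq. (1.1.8) p. 5; lane plumbing] -/
private theorem alg3_coeff_G {k : ℕ} (hk : 3 ≤ k) :
    PowerSeries.coeff k (PowerSeries.C (2 : ℚ) * PowerSeries.X ^ 3 * (1 + PowerSeries.C (4 : ℚ) * PowerSeries.X ^ 2) *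
      PowerSeries.mk (fun i : ℕ => (-2 : ℚ) ^ i) ^ 3) = (-1 : ℚ) ^ (k - 1) * 2 ^ (k - 2) * ((k : ℚ) ^ 2 - 5 * k + 7) := by
  rw [← alg3_iota_cube]
  have hsplit : PowerSeries.C (2 : ℚ) * PowerSeries.X ^ 3 * (1 + PowerSeries.C (4 : ℚ) * PowerSeries.X ^ 2) *
      PowerSeries.mk (fun n : ℕ => ((n : ℚ) + 1) * ((n : ℚ) + 2) / 2 * (-2 : ℚ) ^ n) =
      PowerSeries.X ^ 3 * (PowerSeries.C (2 : ℚ) * PowerSeries.mk (fun n : ℕ => ((n : ℚ) + 1) * ((n : ℚ) + 2) / 2 * (-2 : ℚ) ^ n)) +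
      PowerSeries.X ^ 5 * (PowerSeries.C (8 : ℚ) * PowerSeries.mk (fun n : ℕ => ((n : ℚ) + 1) * ((n : ℚ) + 2) / 2 * (-2 : ℚ) ^ n)) := by
    rw [show PowerSeries.C (8 : ℚ) = PowerSeries.C 2 * PowerSeries.C 4 by rw [← map_mul]; norm_num]
    ring
  rw [hsplit, map_add, PowerSeries.coeff_X_pow_mul', PowerSeries.coeff_X_pow_mul', if_pos hk, PowerSeries.coeff_C_mul,
    PowerSeries.coeff_mk]
  have hm2 : (-2 : ℚ) = (-1) * 2 := by norm_num
  by_cases h5 : 5 ≤ k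
  · rw [if_pos h5, PowerSeries.coeff_C_mul, PowerSeries.coeff_mk]
    obtain ⟨m, rfl⟩ : ∃ m, k = m + 5 := ⟨k - 5, by omega⟩
    rw [show m + 5 - 3 = m + 2 by omega, show m + 5 - 5 = m by omega, show m + 5 - 1 = m + 4 by omega,
      show m + 5 - 2 = m + 3 by omega, hm2, mul_pow, mul_pow]
    push_cast
    ring
  · rw [if_neg h5, add_zero]
    rcases (by omega : k = 3 ∨ k = 4) with rfl | rfl
    · norm_num
    · norm_num

/-- ★ THE THIRD SYMBOL OF THE INVERSE SERIES: if `σ ≡ ι`, `τ ≡ θ`, `υ ≡ κ (mod X^{k+1})` then the third symbol polynomial of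
`E_k = Σ_{j ≤ k} (1 − A_k)^j`, namely `Σ_{j ≤ k} (j (1−σ)^{j−1}(−υ) + C(j,2)(1−σ)^{j−2}τ²)`, has `X^k`-coefficient
`(−1)^{k−1}2^{k−2}(k² − 5k + 7)` for `k ≥ 3`: modulo `X^{k+1}` it is `−κ/ι² + θ²/ι³ = 2X³(1 + 4X²)ι³`
(the geometric sums close up by `alg3_geom2/3`, and `−κι + θ² = 2X³(1+4X²)ι⁶`). [cite: MadrasSlade1993, §1.1 eq. (1.1.8) p. 5; lane lemma] -/
private theorem alg3_E {k : ℕ} {σ τ υ : Polynomial ℚ} (hk : 3 ≤ k)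
    (hσ : (PowerSeries.X : PowerSeries ℚ) ^ (k + 1) ∣ ((σ : PowerSeries ℚ) - PowerSeries.mk (fun i : ℕ => (-2 : ℚ) ^ i)))
    (hτ : (PowerSeries.X : PowerSeries ℚ) ^ (k + 1) ∣ ((τ : PowerSeries ℚ) -
      PowerSeries.C (2 : ℚ) * PowerSeries.X ^ 2 * PowerSeries.mk (fun i : ℕ => (-2 : ℚ) ^ i) ^ 3))
    (hυ : (PowerSeries.X : PowerSeries ℚ) ^ (k + 1) ∣ ((υ : PowerSeries ℚ) -
      -(PowerSeries.C (2 : ℚ) * PowerSeries.X ^ 3 * (1 - PowerSeries.C (2 : ℚ) * PowerSeries.X + PowerSeries.C (4 : ℚ) * PowerSeries.X ^ 2) *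
        PowerSeries.mk (fun i : ℕ => (-2 : ℚ) ^ i) ^ 5))) :
    (∑ j ∈ Finset.range (k + 1), ((j : Polynomial ℚ) * (1 - σ) ^ (j - 1) * (0 - υ) +
      ((j.choose 2 : ℕ) : Polynomial ℚ) * (1 - σ) ^ (j - 2) * (0 - τ) ^ 2)).coeff k =
      (-1 : ℚ) ^ (k - 1) * 2 ^ (k - 2) * ((k : ℚ) ^ 2 - 5 * k + 7) := by
  set ι : PowerSeries ℚ := PowerSeries.mk (fun i : ℕ => (-2 : ℚ) ^ i) with hι
  have hF1' : (1 + PowerSeries.C (2 : ℚ) * PowerSeries.X) * ι = 1 := alg3_iota_mul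
  have hC2 : PowerSeries.C (2 : ℚ) = 2 := map_ofNat _ 2
  have hC4 : PowerSeries.C (4 : ℚ) = 4 := map_ofNat _ 4
  have hG := alg3_coeff_G hk
  rw [← hι, hC2, hC4] at hG
  rw [hC2] at hτ
  rw [hC2, hC4] at hυ
  have hF1 : (1 + 2 * PowerSeries.X) * ι = 1 := by rw [← hC2]; exact hF1'
  -- the polynomial, mapped to power series
  have hQ : (((∑ j ∈ Finset.range (k + 1), ((j : Polynomial ℚ) * (1 - σ) ^ (j - 1) * (0 - υ) +
      ((j.choose 2 : ℕ) : Polynomial ℚ) * (1 - σ) ^ (j - 2) * (0 - τ) ^ 2) : Polynomial ℚ)) : PowerSeries ℚ) =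
      ∑ j ∈ Finset.range (k + 1), (((j : ℕ) : PowerSeries ℚ) * (1 - (σ : PowerSeries ℚ)) ^ (j - 1) * (0 - (υ : PowerSeries ℚ)) +
        ((j.choose 2 : ℕ) : PowerSeries ℚ) * (1 - (σ : PowerSeries ℚ)) ^ (j - 2) * (0 - (τ : PowerSeries ℚ)) ^ 2) := by
    rw [← Polynomial.coeToPowerSeries.ringHom_apply, map_sum]
    refine Finset.sum_congr rfl fun j _ => ?_
    simp only [map_mul, map_pow, map_add, map_sub, map_one, map_zero, map_natCast, Polynomial.coeToPowerSeries.ringHom_apply]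
  set X : PowerSeries ℚ := PowerSeries.X with hX
  set w : PowerSeries ℚ := 1 - ι with hw
  set θ : PowerSeries ℚ := 2 * X ^ 2 * ι ^ 3 with hθ
  set κ : PowerSeries ℚ := -(2 * X ^ 3 * (1 - 2 * X + 4 * X ^ 2) * ι ^ 5) with hκ
  have hw2 : 2 * X * ι = w := by rw [hw]; linear_combination hF1
  have hwX : X ∣ w := by rw [← hw2]; exact Dvd.intro_left 2 (by ring) |>.mul_right ι
  have hθX : X ^ 2 ∣ θ := by rw [hθ]; exact Dvd.intro_left 2 (by ring) |>.mul_right _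
  have hκX : X ^ 3 ∣ κ := by rw [hκ]; exact Dvd.intro (-(2 * (1 - 2 * X + 4 * X ^ 2) * ι ^ 5)) (by ring)
  -- `1 − σ ≡ w` and its powers
  have h1σ : X ^ (k + 1) ∣ (1 - (σ : PowerSeries ℚ)) - w := by
    have : (1 - (σ : PowerSeries ℚ)) - w = -((σ : PowerSeries ℚ) - ι) := by rw [hw]; ring
    rw [this]; exact dvd_neg.2 hσ
  have h1σpow : ∀ m : ℕ, X ^ (k + 1) ∣ (1 - (σ : PowerSeries ℚ)) ^ m - w ^ m := fun m =>
    h1σ.trans (sub_dvd_pow_sub_pow _ _ m)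
  -- the model sum and its distance to the actual one
  set M : PowerSeries ℚ := ∑ j ∈ Finset.range (k + 1), (((j : ℕ) : PowerSeries ℚ) * w ^ (j - 1) * (0 - κ) +
      ((j.choose 2 : ℕ) : PowerSeries ℚ) * w ^ (j - 2) * (0 - θ) ^ 2) with hM
  have hdiff1 : X ^ (k + 1) ∣
      (∑ j ∈ Finset.range (k + 1), (((j : ℕ) : PowerSeries ℚ) * (1 - (σ : PowerSeries ℚ)) ^ (j - 1) * (0 - (υ : PowerSeries ℚ)) +
        ((j.choose 2 : ℕ) : PowerSeries ℚ) * (1 - (σ : PowerSeries ℚ)) ^ (j - 2) * (0 - (τ : PowerSeries ℚ)) ^ 2)) - M := by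
    rw [hM, ← Finset.sum_sub_distrib]
    refine Finset.dvd_sum fun j _ => ?_
    have : (((j : ℕ) : PowerSeries ℚ) * (1 - (σ : PowerSeries ℚ)) ^ (j - 1) * (0 - (υ : PowerSeries ℚ)) +
        ((j.choose 2 : ℕ) : PowerSeries ℚ) * (1 - (σ : PowerSeries ℚ)) ^ (j - 2) * (0 - (τ : PowerSeries ℚ)) ^ 2) -
        (((j : ℕ) : PowerSeries ℚ) * w ^ (j - 1) * (0 - κ) + ((j.choose 2 : ℕ) : PowerSeries ℚ) * w ^ (j - 2) * (0 - θ) ^ 2) =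
        -(((j : ℕ) : PowerSeries ℚ) * ((1 - (σ : PowerSeries ℚ)) ^ (j - 1) * ((υ : PowerSeries ℚ) - κ) +
          ((1 - (σ : PowerSeries ℚ)) ^ (j - 1) - w ^ (j - 1)) * κ)) +
        ((j.choose 2 : ℕ) : PowerSeries ℚ) * ((1 - (σ : PowerSeries ℚ)) ^ (j - 2) * ((τ : PowerSeries ℚ) + θ) * ((τ : PowerSeries ℚ) - θ) +
          ((1 - (σ : PowerSeries ℚ)) ^ (j - 2) - w ^ (j - 2)) * θ ^ 2) := by ring
    rw [this]
    exact dvd_add (dvd_neg.2 (dvd_mul_of_dvd_right (dvd_add (dvd_mul_of_dvd_right hυ _) (dvd_mul_of_dvd_left (h1σpow _) _)) _))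
      (dvd_mul_of_dvd_right (dvd_add (dvd_mul_of_dvd_right hτ _) (dvd_mul_of_dvd_left (h1σpow _) _)) _)
  -- the model in closed form: `2ι³ M = −2κι(1 − (k+1)w^k + k w^{k+1}) + θ²(2 + w^{k−1} Q)`
  obtain ⟨n, rfl⟩ : ∃ n, k = n + 3 := ⟨k - 3, by omega⟩
  have hsum1 : ∑ j ∈ Finset.range (n + 3 + 1), ((j : ℕ) : PowerSeries ℚ) * w ^ (j - 1) * (0 - κ) =
      -(κ * ∑ m ∈ Finset.range (n + 3), ((m + 1 : ℕ) : PowerSeries ℚ) * w ^ m) := by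
    rw [Finset.sum_range_succ' (fun j => ((j : ℕ) : PowerSeries ℚ) * w ^ (j - 1) * (0 - κ)) (n + 3)]
    simp only [Nat.cast_zero, zero_mul, add_zero, Nat.add_sub_cancel, Finset.mul_sum]
    rw [← Finset.sum_neg_distrib]
    exact Finset.sum_congr rfl fun m _ => by ring
  have hsum2 : ∑ j ∈ Finset.range (n + 3 + 1), ((j.choose 2 : ℕ) : PowerSeries ℚ) * w ^ (j - 2) * (0 - θ) ^ 2 =
      θ ^ 2 * ∑ m ∈ Finset.range (n + 2), (((m + 2).choose 2 : ℕ) : PowerSeries ℚ) * w ^ m := by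
    rw [Finset.sum_range_succ' (fun j => ((j.choose 2 : ℕ) : PowerSeries ℚ) * w ^ (j - 2) * (0 - θ) ^ 2) (n + 3),
      Finset.sum_range_succ' (fun j => (((j + 1).choose 2 : ℕ) : PowerSeries ℚ) * w ^ (j + 1 - 2) * (0 - θ) ^ 2) (n + 2)]
    simp only [Nat.choose_zero_succ, Nat.cast_zero, zero_mul, add_zero,
      show ∀ m : ℕ, m + 1 + 1 - 2 = m from fun m => by omega, Finset.mul_sum]
    norm_num
    exact Finset.sum_congr rfl fun m _ => by ring
  have hMclosed : 2 * ι ^ 3 * M = 2 * (-κ * ι + θ ^ 2) +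
      (2 * κ * ι * (((n + 3 + 1 : ℕ) : PowerSeries ℚ) * w ^ (n + 3) - ((n + 3 : ℕ) : PowerSeries ℚ) * w ^ (n + 3 + 1)) +
        θ ^ 2 * (w ^ (n + 2) * (-(((n + 2 : ℕ) : PowerSeries ℚ) ^ 2 + 3 * ((n + 2 : ℕ) : PowerSeries ℚ) + 2) +
          (2 * ((n + 2 : ℕ) : PowerSeries ℚ) ^ 2 + 4 * ((n + 2 : ℕ) : PowerSeries ℚ)) * w -
          (((n + 2 : ℕ) : PowerSeries ℚ) ^ 2 + ((n + 2 : ℕ) : PowerSeries ℚ)) * w ^ 2))) := by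
    have g2 := alg3_geom2 w (n + 3)
    have g3 := alg3_geom3 w (n + 2)
    rw [show (1 : PowerSeries ℚ) - w = ι by rw [hw]; ring] at g2 g3
    rw [hM, Finset.sum_add_distrib, hsum1, hsum2]
    linear_combination (-2 * κ * ι) * g2 + θ ^ 2 * g3
  -- `−κι + θ² = 2X³(1+4X²)ι⁶` (pure ring), so `2ι³(M − G)` is a multiple of `κ w^k` and `θ² w^{k−1}`
  have hdiff2 : X ^ (n + 3 + 1) ∣ M - 2 * X ^ 3 * (1 + 4 * X ^ 2) * ι ^ 3 := by
    apply alg3_dvd_of_dvd_unit_mul 3 2 (by norm_num)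
    rw [show PowerSeries.C (2 : ℚ) = 2 from map_ofNat _ 2, ← hι]
    have : 2 * ι ^ 3 * (M - 2 * X ^ 3 * (1 + 4 * X ^ 2) * ι ^ 3) =
        2 * κ * ι * (((n + 3 + 1 : ℕ) : PowerSeries ℚ) * w ^ (n + 3) - ((n + 3 : ℕ) : PowerSeries ℚ) * w ^ (n + 3 + 1)) +
        θ ^ 2 * (w ^ (n + 2) * (-(((n + 2 : ℕ) : PowerSeries ℚ) ^ 2 + 3 * ((n + 2 : ℕ) : PowerSeries ℚ) + 2) +
          (2 * ((n + 2 : ℕ) : PowerSeries ℚ) ^ 2 + 4 * ((n + 2 : ℕ) : PowerSeries ℚ)) * w -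
          (((n + 2 : ℕ) : PowerSeries ℚ) ^ 2 + ((n + 2 : ℕ) : PowerSeries ℚ)) * w ^ 2)) := by
      rw [mul_sub, hMclosed, hκ, hθ]; ring
    rw [this]
    refine dvd_add ?_ ?_
    · -- `κ · w^{n+3}` has `X^{3 + (n+3)}`
      have h1 : X ^ (n + 3 + 1) ∣ κ * w ^ (n + 3) := by
        have h := mul_dvd_mul hκX (pow_dvd_pow_of_dvd hwX (n + 3))
        rw [← pow_add] at h
        exact (pow_dvd_pow _ (by omega : n + 3 + 1 ≤ 3 + (n + 3))).trans h
      have : 2 * κ * ι * (((n + 3 + 1 : ℕ) : PowerSeries ℚ) * w ^ (n + 3) - ((n + 3 : ℕ) : PowerSeries ℚ) * w ^ (n + 3 + 1)) =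
          κ * w ^ (n + 3) * (2 * ι * (((n + 3 + 1 : ℕ) : PowerSeries ℚ) - ((n + 3 : ℕ) : PowerSeries ℚ) * w)) := by ring
      rw [this]
      exact dvd_mul_of_dvd_left h1 _
    · -- `θ² · w^{n+2}` has `X^{4 + (n+2)}`
      have h1 : X ^ (n + 3 + 1) ∣ θ ^ 2 * w ^ (n + 2) := by
        have h := mul_dvd_mul (pow_dvd_pow_of_dvd hθX 2) (pow_dvd_pow_of_dvd hwX (n + 2))
        rw [← pow_mul, ← pow_add] at h
        exact (pow_dvd_pow _ (by omega : n + 3 + 1 ≤ 2 * 2 + (n + 2))).trans h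
      have : θ ^ 2 * (w ^ (n + 2) * (-(((n + 2 : ℕ) : PowerSeries ℚ) ^ 2 + 3 * ((n + 2 : ℕ) : PowerSeries ℚ) + 2) +
          (2 * ((n + 2 : ℕ) : PowerSeries ℚ) ^ 2 + 4 * ((n + 2 : ℕ) : PowerSeries ℚ)) * w -
          (((n + 2 : ℕ) : PowerSeries ℚ) ^ 2 + ((n + 2 : ℕ) : PowerSeries ℚ)) * w ^ 2)) =
          θ ^ 2 * w ^ (n + 2) * (-(((n + 2 : ℕ) : PowerSeries ℚ) ^ 2 + 3 * ((n + 2 : ℕ) : PowerSeries ℚ) + 2) +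
          (2 * ((n + 2 : ℕ) : PowerSeries ℚ) ^ 2 + 4 * ((n + 2 : ℕ) : PowerSeries ℚ)) * w -
          (((n + 2 : ℕ) : PowerSeries ℚ) ^ 2 + ((n + 2 : ℕ) : PowerSeries ℚ)) * w ^ 2) := by ring
      rw [this]
      exact dvd_mul_of_dvd_left h1 _
  -- combine and read off the coefficient of `X^k`
  have h := dvd_add hdiff1 hdiff2
  rw [sub_add_sub_cancel, ← hQ] at h
  have hc := (PowerSeries.X_pow_dvd_iff.1 h) (n + 3) (Nat.lt_succ_self _)
  rw [map_sub, sub_eq_zero, Polynomial.coeff_coe] at hc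
  rw [hc, ← hG]

end Inverse3


/-! ### Assembly: the symbol triples of `[X^i] A_K` converge to `(ι, θ, κ)`, and `[d^{k−2}] c_k^{(d)} = (−1)^{k−1}2^{k−2}(k²−5k+7)` -/

section Assembly3

/-- A polynomial over `ℚ` is determined by its values on `ℕ`. [cite: MadrasSlade1993, §1.1 eq. (1.1.8) p. 5; lane plumbing] -/
private theorem alg3_poly_eq {P Q : Polynomial ℚ} (h : ∀ d : ℕ, P.eval (d : ℚ) = Q.eval (d : ℚ)) : P = Q := by
  apply Polynomial.eq_of_infinite_eval_eq P Q
  refine Set.Infinite.mono ?_ (Set.infinite_range_of_injective Nat.cast_injective)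
  rintro x ⟨d, rfl⟩
  exact h d

/-- ★ For every `K` there are symbol polynomials `σ_K ≡ ι = (1+2X)⁻¹`, `τ_K ≡ θ = 2X²ι³` and `υ_K ≡ κ = −2X³(1 − 2X + 4X²)ι⁵ (mod X^{K+1})`
of the family `d ↦ A_K(N(ℤ^{d+1}))`: the coefficient `[X^i] A_K`, `i ≤ K`, is a polynomial in `d` of degree `≤ i` with `d^i`-, `d^{i−1}`-
and `d^{i−2}`-coefficients `[X^i]σ_K`, `[X^i]τ_K`, `[X^i]υ_K`. (Top and second symbols are those of `SAWPulledLargeForceExpansionZdSecondSymbol`,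
identified by uniqueness of the polynomial; the third is new.) [cite: MadrasSlade1993, §1.1 eq. (1.1.8) p. 5; lane theorem] -/
theorem exists_symbolTriple_coeff_A (K : ℕ) : ∃ σ τ υ : Polynomial ℚ,
    (PowerSeries.X : PowerSeries ℚ) ^ (K + 1) ∣ ((σ : PowerSeries ℚ) - PowerSeries.mk (fun i : ℕ => (-2 : ℚ) ^ i)) ∧
    (PowerSeries.X : PowerSeries ℚ) ^ (K + 1) ∣ ((τ : PowerSeries ℚ) -
      PowerSeries.C (2 : ℚ) * PowerSeries.X ^ 2 * PowerSeries.mk (fun i : ℕ => (-2 : ℚ) ^ i) ^ 3) ∧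
    (PowerSeries.X : PowerSeries ℚ) ^ (K + 1) ∣ ((υ : PowerSeries ℚ) -
      -(PowerSeries.C (2 : ℚ) * PowerSeries.X ^ 3 * (1 - PowerSeries.C (2 : ℚ) * PowerSeries.X + PowerSeries.C (4 : ℚ) * PowerSeries.X ^ 2) *
        PowerSeries.mk (fun i : ℕ => (-2 : ℚ) ^ i) ^ 5)) ∧
    ∀ i ≤ K, ∃ P : Polynomial ℚ, P.natDegree ≤ i ∧ P.coeff i = σ.coeff i ∧ (P * Polynomial.X).coeff i = τ.coeff i ∧
      (P * Polynomial.X ^ 2).coeff i = υ.coeff i ∧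
      ∀ d : ℕ, (((CostSeries.A (costCoeffZd d) K).coeff i : ℤ) : ℚ) = P.eval (d : ℚ) := by
  induction K with
  | zero =>
    refine ⟨1, 0, 0, ?_, ?_, ?_, fun i hi => ?_⟩
    · rw [zero_add, PowerSeries.X_pow_dvd_iff]
      intro m hm
      obtain rfl : m = 0 := by omega
      rw [map_sub, Polynomial.coe_one, PowerSeries.coeff_mk, sub_eq_zero, pow_zero]
      exact PowerSeries.coeff_zero_one
    · rw [zero_add, pow_one, Polynomial.coe_zero, zero_sub, dvd_neg]
      exact Dvd.intro (PowerSeries.C (2 : ℚ) * PowerSeries.X * PowerSeries.mk (fun i : ℕ => (-2 : ℚ) ^ i) ^ 3) (by ring)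
    · rw [zero_add, pow_one, Polynomial.coe_zero, zero_sub, dvd_neg, dvd_neg]
      exact Dvd.intro (PowerSeries.C (2 : ℚ) * PowerSeries.X ^ 2 *
        (1 - PowerSeries.C (2 : ℚ) * PowerSeries.X + PowerSeries.C (4 : ℚ) * PowerSeries.X ^ 2) *
        PowerSeries.mk (fun i : ℕ => (-2 : ℚ) ^ i) ^ 5) (by ring)
    · obtain ⟨P, hP, hPa, hPb, hPc, h⟩ := gsym3_one 0 i hi
      exact ⟨P, hP, hPa, hPb, hPc, fun d => by rw [← h d, CostSeries.A]⟩
  | succ K ih =>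
    obtain ⟨σ, τ, υ, hσ, hτ, hυ, hA⟩ := ih
    have hstep := gsym3_A_succ hA
    have hυ' := alg3_A_step_third hσ hτ hυ
    obtain ⟨σ', τ', hσ', hτ', hB⟩ := exists_symbolPair_coeff_A (K + 1)
    refine ⟨σ', τ', _, hσ', hτ', hυ', fun i hi => ?_⟩
    obtain ⟨P, hP, hPa, hPb, hPc, hev⟩ := hstep i hi
    obtain ⟨Q, -, hQa, hQb, hQev⟩ := hB i hi
    have hPQ : P = Q := alg3_poly_eq fun d => by rw [← hev d, hQev d]
    exact ⟨P, hP, by rw [hPQ, hQa], by rw [hPQ, hQb], hPc, hev⟩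

/-- ★★★ THE SECOND COEFFICIENT OF `c_k^{(d)}` IN THE DIMENSION: for every `k ≥ 3`, `d ↦ c_k^{(d)} = largeForceCoeffZd d k` is a
polynomial over `ℚ` of degree EXACTLY `k − 1` with leading coefficient `(−2)^{k−1}` (`SAWPulledLargeForceExpansionZdSecondSymbol`) and
`d^{k−2}`-coefficient `(−1)^{k−1} 2^{k−2} (k² − 5k + 7)` — the lane's observed law `2, −12, 56, −208, 672, −1984` (`k = 3 … 8`; `5504`,
`−14592` at `k = 9, 10`) for EVERY `k`. Proof: `c_k^{(d)} = [X^k] E_k`, `E_k = Σ_{j≤k} (1 − A_k)^j`; the third symbol of `E_k` is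
`[X^k](−κ/ι² + θ²/ι³) = [X^k] 2X³(1 + 4X²)(1 + 2X)⁻³` (`alg3_E`), where `κ` is the third symbol of the fixed point
(`exists_symbolTriple_coeff_A`, fed by the census third symbol `exists_polynomial_costCoeffZd_topThree`: the unit-square class of
`SAWCountZdThirdCoefficient` on the span-one cells and the one-down-step class of `SAWIrreducibleBridgeSpanTwoTopClassCount` on the span-two
cells). [cite: MadrasSlade1993, §1.1 eq. (1.1.8) p. 5; §4.2 eq. (4.2.20)–(4.2.22); lane theorem] -/
theorem exists_polynomial_largeForceCoeffZd_secondCoeff {k : ℕ} (hk : 3 ≤ k) :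
    ∃ P : Polynomial ℚ, P.natDegree = k - 1 ∧ P.leadingCoeff = (-2 : ℚ) ^ (k - 1) ∧
      P.coeff (k - 2) = (-1 : ℚ) ^ (k - 1) * 2 ^ (k - 2) * ((k : ℚ) ^ 2 - 5 * k + 7) ∧
      ∀ d : ℕ, (largeForceCoeffZd d k : ℚ) = P.eval (d : ℚ) := by
  obtain ⟨σ, τ, υ, hσ, hτ, hυ, hA⟩ := exists_symbolTriple_coeff_A k
  -- the family `1 − A_k` has symbol triple `(1 − σ, −τ, −υ)`; its powers and their sum
  have h1 : ∀ i ≤ k, ∃ P : Polynomial ℚ, P.natDegree ≤ i ∧ P.coeff i = (1 - σ).coeff i ∧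
      (P * Polynomial.X).coeff i = (0 - τ).coeff i ∧ (P * Polynomial.X ^ 2).coeff i = (0 - υ).coeff i ∧
      ∀ d : ℕ, (((1 - CostSeries.A (costCoeffZd d) k).coeff i : ℤ) : ℚ) = P.eval (d : ℚ) :=
    gsym3_sub (S := fun _ => (1 : Polynomial ℤ)) (gsym3_one k) hA
  have hE : ∀ i ≤ k, ∃ P : Polynomial ℚ, P.natDegree ≤ i ∧
      P.coeff i = (∑ j ∈ Finset.range (k + 1), (1 - σ) ^ j).coeff i ∧
      (P * Polynomial.X).coeff i = (∑ j ∈ Finset.range (k + 1), (j : Polynomial ℚ) * (1 - σ) ^ (j - 1) * (0 - τ)).coeff i ∧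
      (P * Polynomial.X ^ 2).coeff i = (∑ j ∈ Finset.range (k + 1), ((j : Polynomial ℚ) * (1 - σ) ^ (j - 1) * (0 - υ) +
        ((j.choose 2 : ℕ) : Polynomial ℚ) * (1 - σ) ^ (j - 2) * (0 - τ) ^ 2)).coeff i ∧
      ∀ d : ℕ, (((∑ j ∈ Finset.range (k + 1), (1 - CostSeries.A (costCoeffZd d) k) ^ j).coeff i : ℤ) : ℚ) = P.eval (d : ℚ) :=
    gsym3_sum (Finset.range (k + 1)) (S := fun j d => (1 - CostSeries.A (costCoeffZd d) k) ^ j) (σ := fun j => (1 - σ) ^ j)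
      (τ := fun j => (j : Polynomial ℚ) * (1 - σ) ^ (j - 1) * (0 - τ))
      (υ := fun j => (j : Polynomial ℚ) * (1 - σ) ^ (j - 1) * (0 - υ) + ((j.choose 2 : ℕ) : Polynomial ℚ) * (1 - σ) ^ (j - 2) * (0 - τ) ^ 2)
      (fun j _ => gsym3_pow (S := fun d => 1 - CostSeries.A (costCoeffZd d) k) h1 j)
  obtain ⟨P, -, -, -, hPc, h⟩ := hE k le_rfl
  have hev : ∀ d : ℕ, (largeForceCoeffZd d k : ℚ) = P.eval (d : ℚ) := fun d => by
    rw [← h d, largeForceCoeffZd, CostSeries.e, CostSeries.E]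
  -- the third coefficient
  have hthird : (P * Polynomial.X ^ 2).coeff k = (-1 : ℚ) ^ (k - 1) * 2 ^ (k - 2) * ((k : ℚ) ^ 2 - 5 * k + 7) := by
    rw [hPc]; exact alg3_E hk hσ hτ hυ
  -- degree and leading coefficient from the second-symbol file, by uniqueness of the polynomial
  obtain ⟨Q, hQdeg, hQlead, hQev⟩ := exists_polynomial_largeForceCoeffZd_natDegree_eq (show 2 ≤ k by omega)
  have hPQ : P = Q := alg3_poly_eq fun d => by rw [← hev d, hQev d]
  refine ⟨Q, hQdeg, hQlead, ?_, hQev⟩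
  obtain ⟨m, rfl⟩ : ∃ m, k = m + 2 := ⟨k - 2, by omega⟩
  rw [Nat.add_sub_cancel, ← Polynomial.coeff_mul_X_pow Q 2 m, ← hPQ, hthird, Nat.add_sub_cancel]

/-- ★★★ The same statement with the degree bound only (convenient for symbol calculus one order up):
`deg ≤ k − 1`, `[X^{k−1}] = (−2)^{k−1}`, `[X^{k−2}] = (−1)^{k−1}2^{k−2}(k²−5k+7)`. [cite: MadrasSlade1993, §1.1 eq. (1.1.8) p. 5; lane theorem] -/
theorem exists_polynomial_largeForceCoeffZd_topThree {k : ℕ} (hk : 3 ≤ k) :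
    ∃ P : Polynomial ℚ, P.natDegree ≤ k - 1 ∧ P.coeff (k - 1) = (-2 : ℚ) ^ (k - 1) ∧
      P.coeff (k - 2) = (-1 : ℚ) ^ (k - 1) * 2 ^ (k - 2) * ((k : ℚ) ^ 2 - 5 * k + 7) ∧
      ∀ d : ℕ, (largeForceCoeffZd d k : ℚ) = P.eval (d : ℚ) := by
  obtain ⟨P, hdeg, hlead, hsec, hev⟩ := exists_polynomial_largeForceCoeffZd_secondCoeff hk
  refine ⟨P, hdeg.le, ?_, hsec, hev⟩
  rw [Polynomial.leadingCoeff, hdeg] at hlead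
  exact hlead

end Assembly3


end Literature.Probability.RandomPlanarGeometry.SAW.Zd
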